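import Literature.NumberTheory.Rogawski1990.ArchOrbFamGExtBoxDescent                 -- ★ p851016 (LH3-p04 (g4)): the GLOBAL template; brings (B-STD) `exists_std_package`, (M-UNFOLD) ★ p850446∕p850499 + (V9), block descent, cut-offs, Hörmander
import Literature.NumberTheory.Automorphic.ArchInnerFormChartLocal                  -- ★ (LH3-p02): `gprimeBlockAt`, `chartTorusGLoc`, `forall_mem_chartTorusGLoc_comm`, `continuous_descConj_gprimeBlockAt`
import Literature.MeasureTheory.Group.OrbitalDescentChartTorus                      -- ★ D3 `integral_descConj_eq_integral_descConj_descended` (generic Harish-Chandra descent)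
import Literature.NumberTheory.Automorphic.ArchLocalTorusOrbitalBlockSmooth         -- ★ Hörmander engine `contDiffAt_integral_comp_of_contDiff_of_support`
import Literature.NumberTheory.Rogawski1990.ArchOrbFamGSmoothModel                  -- ★ (A4) `contDiff_coe_gprimeBlock`
import HarnessLib

/-!
# (H-core) L1 — THE ONE-PLACE PARAMETRIC BLOCK STEP: Harish-Chandra's wall descent in `U(α)_{w₀}` for a smooth FAMILY of test functions
# (Rogawski 1990 §4.12 Lemma 4.12.1, §8.2 pp. 119–124; Harish-Chandra–van Dijk 1970 I §3; Shelstad 1979 §4)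

Topic `NumberTheory/Rogawski1990`; namespaces `Literature.NumberTheory.Automorphic.UnitaryGroup` (§1) and `Literature.NumberTheory.Rogawski1990` (§2–§4).  THEOREMS ONLY
(no `def`, no instance, no notation, no axiom, no named fact, no `sorry`); kernel lane `--kind proof --supports stmt-HodgeConjecture-24833`.  Cell `pub/hodgecm-mathlib`,
crux H413 (`stmt-HodgeConjecture-24833`), F0∕P3c line LH3 (closer stub `stub_N9`), LETTER L1 clause (I₃)∕(I₁) at a non-generic face point: the (H-core) «THREE HANDS» plan of
LH5-p02 (g4) (2026-09-02), hand (1) = L1 (LH3-plan (g4) HANDS NAMED 11:13:39Z → LH1-p03 (g6)); L2 = (A5a′) F0P3b-p01 (g17); L3 = assembly LH5-p02 (g4) ending with the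
(B-desc′) ED. 2 head `exists_descent_box_orbFamGExt_inRegG`.  Binder of record for this file's head: LH5-p02 (g4).

THE MATHEMATICS.  ★ p851016 `exists_descent_box_chartOrbG` is Harish-Chandra's descent for the GLOBAL group `G′_∞ = Π_w U(α)_w` at a semiregular chart point, with ONE test
function `a′`.  This file is the same descent at ONE place `w₀` (compact chart at `w₀`, i.e. `w₀ ∉ S`; `U(α)_{w₀} ≅ U(2,1)` indefinite, `w₀ ∈ splitChartPlaces`) for a smooth
FAMILY `B(y, ·) = Ξ(y, ↑↑·)` of test functions on `G₀ := U(α)_{w₀}` with `g`-support uniform near the base parameter `y₀`: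
* §1 the LOCAL (M-UNFOLD) shadow `e : Z_{G₀}(γ₀(x₀)) ≃ₜ* B_{w₀} × K₀` (`γ₀ = gprimeBlockAt α w₀ S`, `x₀` on the noncompact wall `(0,2)`: `e^{ix₀0} = e^{ix₀2} ≠ e^{ix₀1}`;
  `B_{w₀} = U(σ_{w₀} diag(α_{τ₀0}, α_{τ₀2}))(ℂ)`, `K₀ ≅ U(1)` the middle slot) with the one-place clauses [4] [5] [6] [7] [8] [10] of ★ p850446∕p850499 for the local chart
  torus `T₀ = chartTorusGLoc α w₀ S` — ★ (V9) `exists_centralizer_continuousMulEquiv_of_splitSingular` relabelled by `e_{τ₀}` (p850499's construction with the place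
  projection removed);
* §2 Harish-Chandra's compactness at `w₀` ACROSS the wall, group level, on a closed ball of coordinates (★ D1c∕D4b-1 `uniformlyProper_gprimeBlock_cpt_of_ne` modulo
  `Z(γ₀(x₀)) ≥ Stab(e_{τ₀1})`);
* §3 (aM-SMOOTH) WITH PARAMETERS: `Θ(y, X) := ∫_{G₀} β(x) • Ξ(y, ↑↑x · X · ↑↑x⁻¹) dν₀(x)` is jointly `C^∞` (Hörmander, `S := tsupport β`);
* §4 the head **`exists_descent_box_local_param`**: `K ≠ 0`, open `O ∋ y₀`, `V ∋ x₀` and ONE jointly smooth `f : (P × ℝ³) × M₂(ℂ) → ℂ`, compactly supported in the matrix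
  variable uniformly, depending on `cw` only through `cw 1`, with
  `∫_{G₀⧸T₀} B(y)(q γ₀(cw) q⁻¹) d(ν₀∕t₀) = K · ∫_{U(J)} f((y, cw), ↑↑(h · P diag(e^{icw0}, e^{icw2}) P⁻¹ · h⁻¹)) dμ₀(h)` for `y ∈ O`, `cw ∈ V` regular —
  ★ (B-STD) `exists_std_package` → Haar on `Z(γ₀ x₀)` by the product decomposition → ★ `exists_smul_map_mk_of_block_compact` → ONE cut-off `β` → ★ D3 (its integrability
  input proved here: at a compact-chart place `T₀` is compact) → ★ `integral_descConj_eq_smul_integral_of_block`.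
HONEST LABEL: HC_CM is proved only modulo the 7 printed citations (2 remaining: hLiu418 = `stmt-HodgeConjecture-24832`, h413 = `stmt-HodgeConjecture-24833`) until rung 0
closes; count-neutral letter-L1 plumbing.

## References
* [Rogawski1990] J. D. Rogawski, *Automorphic Representations of Unitary Groups in Three Variables*, Ann. of Math. Stud. 123 (1990), §4.12 Lemma 4.12.1 p. 66, §8.2 pp. 119–124,
  §4.8 Case (a) p. 53.
* [HarishChandra1970] Harish-Chandra (notes by G. van Dijk), *Harmonic Analysis on Reductive p-adic Groups*, LNM 162 (1970), Part I §3 Lemmas 22–23.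
* [Shelstad1979] D. Shelstad, *Characters and inner forms of a quasi-split group over ℝ*, Compositio Math. 39 (1979), §4 pp. 22–25.
* [HormanderALPDO1] L. Hörmander, *The Analysis of Linear Partial Differential Operators I* (1990), Thm. 1.1.9.
* [DeitmarEchterhoff2014] A. Deitmar, S. Echterhoff, *Principles of Harmonic Analysis*, 2nd ed. (2014), Thm. 1.5.3, Lemma 9.3.3.
-/

set_option autoImplicit false

noncomputable section

open MeasureTheory MeasureTheory.Measure NumberField NumberField.InfinitePlace Matrix Complex Set Filter Topology
open scoped MatrixGroups Matrix Real Classical ENNReal NNReal ContDiff Matrix.Norms.Operator Pointwise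
open Literature.NumberTheory.Rogawski1990 Literature.LinearAlgebra.Matrix Literature.MeasureTheory.Group

namespace Literature.NumberTheory.Automorphic.UnitaryGroup

/-! ## §1 The LOCAL (M-UNFOLD) shadow at `w₀`: `Z_{U(α)_{w₀}}(γ₀(x₀)) ≃ₜ* B_{w₀} × K₀` with the one-place torus clauses -/

section LocalUnfold

variable (L : Type) [Field L] [NumberField L] [IsCMField L] (α : Fin 3 → L)
  (S' : Finset {w : InfinitePlace L // IsComplex w}) (w₀ : {w : InfinitePlace L // IsComplex w})

/-- Every local chart point commutes with every other: `gprimeBlockAt cw ∈ Z(gprimeBlockAt x₀)`. [cite: Rogawski1990, §3.6 p. 31] -/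
theorem gprimeBlockAt_mem_centralizer (x₀ cw : Fin 3 → ℝ) :
    gprimeBlockAt L α w₀ S' cw ∈ Subgroup.centralizer ({gprimeBlockAt L α w₀ S' x₀} : Set ↥(archLocal L 3 (Matrix.diagonal α) w₀)) := by
  rw [Subgroup.mem_centralizer_singleton_iff]
  exact gprimeBlockAt_comm L α w₀ S' cw x₀

set_option maxHeartbeats 800000 in
/-- **LOCAL (M-UNFOLD) AT ONE PLACE, EXPLICIT FORM.**  `w₀ ∉ S′` (compact chart at `w₀`), `x₀` on the wall `e^{ix₀0} = e^{ix₀2} ≠ e^{ix₀1}`: there are a closed commutative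
`K₀ ≤ Z(γ₀(x₀))` inside the local chart torus `T₀ = chartTorusGLoc α w₀ S′` and `e : Z(γ₀(x₀)) ≃ₜ* B_{w₀} × K₀` with: [4] `g ∈ T₀ ↔ (e g).1` unit diagonal; [5] the `B`-component of
`γ₀(cw)` is `diag(e^{icw0}, e^{icw2})`; [6] its `K₀`-component is `γ₀(0, cw1, 0)`; [7] `e(T₀) = A × ⊤`; [8] `e⁻¹(b, 1) = e_{τ₀}(ι(b, 1))` (relabelled block embedding); [10] `e k = (1, k)` on
`K₀` — the one-place shadow of ★ p850446∕p850499. [cite: Rogawski1990, §8.2 p. 122; §4.12; §4.8 Case (a) p. 53] [cite: Knapp1986, Ch. V §3] -/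
theorem exists_continuousMulEquiv_centralizer_gprimeBlockAt_wall_explicit (hα : ∀ i, α i ≠ 0) (hw₀ : w₀ ∉ S') (x₀ : Fin 3 → ℝ)
    (h02 : Circle.exp (x₀ 0) = Circle.exp (x₀ 2)) (h01 : Circle.exp (x₀ 0) ≠ Circle.exp (x₀ 1)) :
    ∃ (K : Subgroup ↥(Subgroup.centralizer ({gprimeBlockAt L α w₀ S' x₀} : Set ↥(archLocal L 3 (Matrix.diagonal α) w₀))))
      (e : ↥(Subgroup.centralizer ({gprimeBlockAt L α w₀ S' x₀} : Set ↥(archLocal L 3 (Matrix.diagonal α) w₀))) ≃ₜ*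
        ↥(unitaryGroupOfForm (starRingEnd ℂ) ((Matrix.diagonal ![α (lineOf (formSign L α w₀) 0), α (lineOf (formSign L α w₀) 2)]).map w₀.1.embedding)) × ↥K),
      IsClosed (K : Set ↥(Subgroup.centralizer ({gprimeBlockAt L α w₀ S' x₀} : Set ↥(archLocal L 3 (Matrix.diagonal α) w₀)))) ∧
      (∀ k : ↥(Subgroup.centralizer ({gprimeBlockAt L α w₀ S' x₀} : Set ↥(archLocal L 3 (Matrix.diagonal α) w₀))),
        k ∈ K → (k : ↥(archLocal L 3 (Matrix.diagonal α) w₀)) ∈ chartTorusGLoc L α w₀ S') ∧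
      (∀ k₁, k₁ ∈ K → ∀ k₂, k₂ ∈ K → k₁ * k₂ = k₂ * k₁) ∧
      (∀ g : ↥(Subgroup.centralizer ({gprimeBlockAt L α w₀ S' x₀} : Set ↥(archLocal L 3 (Matrix.diagonal α) w₀))),
        (g : ↥(archLocal L 3 (Matrix.diagonal α) w₀)) ∈ chartTorusGLoc L α w₀ S' ↔
        (((e g).1 : ↥(unitaryGroupOfForm (starRingEnd ℂ) ((Matrix.diagonal ![α (lineOf (formSign L α w₀) 0), α (lineOf (formSign L α w₀) 2)]).map w₀.1.embedding))) :
          GL (Fin 2) ℂ) ∈ Set.range (circleDiagonal 2)) ∧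
      (∀ cw : Fin 3 → ℝ,
        (((e ⟨gprimeBlockAt L α w₀ S' cw, gprimeBlockAt_mem_centralizer L α S' w₀ x₀ cw⟩).1 :
          ↥(unitaryGroupOfForm (starRingEnd ℂ) ((Matrix.diagonal ![α (lineOf (formSign L α w₀) 0), α (lineOf (formSign L α w₀) 2)]).map w₀.1.embedding))) : GL (Fin 2) ℂ) =
          circleDiagonal 2 ![Circle.exp (cw 0), Circle.exp (cw 2)]) ∧
      (∀ cw : Fin 3 → ℝ,
        ((((e ⟨gprimeBlockAt L α w₀ S' cw, gprimeBlockAt_mem_centralizer L α S' w₀ x₀ cw⟩).2 : ↥K) :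
          ↥(Subgroup.centralizer ({gprimeBlockAt L α w₀ S' x₀} : Set ↥(archLocal L 3 (Matrix.diagonal α) w₀)))) : ↥(archLocal L 3 (Matrix.diagonal α) w₀)) =
          gprimeBlockAt L α w₀ S' ![0, cw 1, 0]) ∧
      Subgroup.map (e : ↥(Subgroup.centralizer ({gprimeBlockAt L α w₀ S' x₀} : Set ↥(archLocal L 3 (Matrix.diagonal α) w₀))) →*
          ↥(unitaryGroupOfForm (starRingEnd ℂ) ((Matrix.diagonal ![α (lineOf (formSign L α w₀) 0), α (lineOf (formSign L α w₀) 2)]).map w₀.1.embedding)) × ↥K)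
        ((chartTorusGLoc L α w₀ S').subgroupOf (Subgroup.centralizer ({gprimeBlockAt L α w₀ S' x₀} : Set ↥(archLocal L 3 (Matrix.diagonal α) w₀)))) =
        (((circleDiagonal 2).codRestrict (unitaryGroupOfForm (starRingEnd ℂ) ((Matrix.diagonal ![α (lineOf (formSign L α w₀) 0), α (lineOf (formSign L α w₀) 2)]).map w₀.1.embedding))
            (circleDiagonal_mem_archLocal_diagonal L 2 ![α (lineOf (formSign L α w₀) 0), α (lineOf (formSign L α w₀) 2)] w₀)).range).prod ⊤ ∧
      -- [8] the inverse on `B × 1` is the relabelled block embedding `e_{τ₀} ∘ ι`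
      (∀ b : ↥(unitaryGroupOfForm (starRingEnd ℂ) ((Matrix.diagonal ![α (lineOf (formSign L α w₀) 0), α (lineOf (formSign L α w₀) 2)]).map w₀.1.embedding)),
        ((e.symm (b, 1) : ↥(Subgroup.centralizer ({gprimeBlockAt L α w₀ S' x₀} : Set ↥(archLocal L 3 (Matrix.diagonal α) w₀)))) : ↥(archLocal L 3 (Matrix.diagonal α) w₀)) =
          (ContinuousMulEquiv.restrictSubgroup
            (GLn.conjEquiv (Matrix.GeneralLinearGroup.mkOfDetNeZero _ (det_monomial_one_ne_zero 3 (lineOf (formSign L α w₀)))))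
            (archLocal L 3 (Matrix.diagonal (α ∘ (lineOf (formSign L α w₀)))) w₀) (archLocal L 3 (Matrix.diagonal α) w₀)
            (mem_archLocal_comp_perm_iff_conj_mem L 3 α w₀ (lineOf (formSign L α w₀))))
            ((endoEmb (starRingEnd ℂ) ((Matrix.diagonal ![(α ∘ (lineOf (formSign L α w₀))) 0, (α ∘ (lineOf (formSign L α w₀))) 2]).map w₀.1.embedding)
              ((Matrix.diagonal ![(α ∘ (lineOf (formSign L α w₀))) 1]).map w₀.1.embedding) ((Matrix.diagonal (α ∘ (lineOf (formSign L α w₀)))).map w₀.1.embedding)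
              (endoForm_archLocal_diagonal L (α ∘ (lineOf (formSign L α w₀))) w₀)) (b, 1))) ∧
      -- [10] `e` is the identity on `K₀`
      (∀ k : ↥(Subgroup.centralizer ({gprimeBlockAt L α w₀ S' x₀} : Set ↥(archLocal L 3 (Matrix.diagonal α) w₀))), ∀ hk : k ∈ K, e k = (1, ⟨k, hk⟩)) := by
  classical
  -- §A  Notation: the local group, the relabelling at `w₀`, the standard wall point `diag z₀` in `G_{w₀}(α ∘ τ₀)`.
  let τ₀ : Fin 3 ≃ Fin 3 := lineOf (formSign L α w₀)
  let G := ↥(archLocal L 3 (Matrix.diagonal α) w₀)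
  let eτ : ↥(unitaryGroupOfForm (starRingEnd ℂ) ((Matrix.diagonal (α ∘ τ₀)).map w₀.1.embedding)) ≃ₜ* G :=
    ContinuousMulEquiv.restrictSubgroup (GLn.conjEquiv (Matrix.GeneralLinearGroup.mkOfDetNeZero _ (det_monomial_one_ne_zero 3 τ₀)))
      (archLocal L 3 (Matrix.diagonal (α ∘ τ₀)) w₀) (archLocal L 3 (Matrix.diagonal α) w₀) (mem_archLocal_comp_perm_iff_conj_mem L 3 α w₀ τ₀)
  let z₀ : Fin 3 → Circle := fun k => Circle.exp (x₀ k)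
  let d₀ : ↥(unitaryGroupOfForm (starRingEnd ℂ) ((Matrix.diagonal (α ∘ τ₀)).map w₀.1.embedding)) :=
    ⟨circleDiagonal 3 z₀, circleDiagonal_mem_archLocal_diagonal L 3 (α ∘ τ₀) w₀ z₀⟩
  let ι := endoEmb (starRingEnd ℂ) ((Matrix.diagonal ![(α ∘ τ₀) 0, (α ∘ τ₀) 2]).map w₀.1.embedding) ((Matrix.diagonal ![(α ∘ τ₀) 1]).map w₀.1.embedding)
      ((Matrix.diagonal (α ∘ τ₀)).map w₀.1.embedding) (endoForm_archLocal_diagonal L (α ∘ τ₀) w₀)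
  let M' : Subgroup G := Subgroup.centralizer ({gprimeBlockAt L α w₀ S' x₀} : Set G)
  have hz02 : z₀ 0 = z₀ 2 := h02
  have hz01 : z₀ 0 ≠ z₀ 1 := h01
  -- ★ (V9) at `α ∘ τ₀`: the centraliser of the standard wall point is the block group, `e9⁻¹ = ι` on the nose.
  obtain ⟨e9, he9⟩ := exists_centralizer_continuousMulEquiv_of_splitSingular L (α ∘ τ₀) w₀ (z := z₀) hz02 hz01
  -- the wall point and every chart point, read through the relabelling
  have hblk : ∀ cw : Fin 3 → ℝ,
      gprimeBlockAt L α w₀ S' cw = eτ ⟨circleDiagonal 3 (fun k => Circle.exp (cw k)), circleDiagonal_mem_archLocal_diagonal L 3 (α ∘ τ₀) w₀ _⟩ :=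
    fun cw => by exact gprimeBlock_eq_relabel_circleDiagonal L α hw₀ (fun _ => cw)
  have hwall : gprimeBlockAt L α w₀ S' x₀ = eτ d₀ := hblk x₀
  have hdι : ∀ cw : Fin 3 → ℝ,
      (⟨circleDiagonal 3 (fun k => Circle.exp (cw k)), circleDiagonal_mem_archLocal_diagonal L 3 (α ∘ τ₀) w₀ _⟩ :
        ↥(unitaryGroupOfForm (starRingEnd ℂ) ((Matrix.diagonal (α ∘ τ₀)).map w₀.1.embedding))) =
        ι (⟨circleDiagonal 2 ![Circle.exp (cw 0), Circle.exp (cw 2)], (circleDiagonal_blocks_mem L (α ∘ τ₀) w₀ (fun k => Circle.exp (cw k))).1⟩,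
          ⟨circleDiagonal 1 ![Circle.exp (cw 1)], (circleDiagonal_blocks_mem L (α ∘ τ₀) w₀ (fun k => Circle.exp (cw k))).2⟩) :=
    fun cw => circleDiagonal_eq_endoEmb L (α ∘ τ₀) w₀ (fun k => Circle.exp (cw k))
  have hd₀ι : d₀ = ι (⟨circleDiagonal 2 ![z₀ 0, z₀ 2], (circleDiagonal_blocks_mem L (α ∘ τ₀) w₀ z₀).1⟩, ⟨circleDiagonal 1 ![z₀ 1], (circleDiagonal_blocks_mem L (α ∘ τ₀) w₀ z₀).2⟩) :=
    circleDiagonal_eq_endoEmb L (α ∘ τ₀) w₀ z₀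
  -- §B  `ψ g = e_{τ₀}⁻¹ g` lands in `Z(d₀)`.
  let ψ : ↥M' →* ↥(unitaryGroupOfForm (starRingEnd ℂ) ((Matrix.diagonal (α ∘ τ₀)).map w₀.1.embedding)) :=
    (eτ.symm : G →* ↥(unitaryGroupOfForm (starRingEnd ℂ) ((Matrix.diagonal (α ∘ τ₀)).map w₀.1.embedding))).comp M'.subtype
  have hψ_apply : ∀ g : ↥M', ψ g = eτ.symm (g : G) := fun g => rfl
  have hψ_mem : ∀ g : ↥M', ψ g ∈ Subgroup.centralizer ({d₀} : Set ↥(unitaryGroupOfForm (starRingEnd ℂ) ((Matrix.diagonal (α ∘ τ₀)).map w₀.1.embedding))) := by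
    intro g
    rw [Subgroup.mem_centralizer_singleton_iff, hψ_apply]
    have hg : (g : G) * gprimeBlockAt L α w₀ S' x₀ = gprimeBlockAt L α w₀ S' x₀ * g := Subgroup.mem_centralizer_singleton_iff.1 g.2
    rw [hwall] at hg
    have h := congrArg eτ.symm hg
    simpa only [map_mul, ContinuousMulEquiv.symm_apply_apply] using h
  let ψ' : ↥M' →* ↥(Subgroup.centralizer ({d₀} : Set ↥(unitaryGroupOfForm (starRingEnd ℂ) ((Matrix.diagonal (α ∘ τ₀)).map w₀.1.embedding)))) :=
    ψ.codRestrict _ hψ_mem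
  -- the block projection `prj = e9 ∘ ψ′ : M′ →* B × U₁` and `π_B`
  let prj : ↥M' →* ↥(unitaryGroupOfForm (starRingEnd ℂ) ((Matrix.diagonal ![(α ∘ τ₀) 0, (α ∘ τ₀) 2]).map w₀.1.embedding)) ×
      ↥(unitaryGroupOfForm (starRingEnd ℂ) ((Matrix.diagonal ![(α ∘ τ₀) 1]).map w₀.1.embedding)) :=
    (e9 : _ →* _).comp ψ'
  let prB := (MonoidHom.fst _ _).comp prj
  have hprB_apply : ∀ g : ↥M', prB g = (prj g).1 := fun _ => rfl
  -- KEY: `ι (prj g) = ψ g`, i.e. `g = e_{τ₀} (ι (prj g))` for `g ∈ M′`.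
  have hιprj : ∀ g : ↥M', ι (prj g) = ψ g := by
    intro g
    have h1 : ((e9.symm (prj g) : ↥(Subgroup.centralizer ({d₀} : Set _))) : ↥(unitaryGroupOfForm (starRingEnd ℂ) ((Matrix.diagonal (α ∘ τ₀)).map w₀.1.embedding))) = ι (prj g) :=
      he9 (prj g)
    rw [← h1]
    show ((e9.symm (e9 (ψ' g)) : ↥(Subgroup.centralizer ({d₀} : Set _))) : _) = ψ g
    rw [ContinuousMulEquiv.symm_apply_apply]
    rfl
  have hcomp : ∀ g : ↥M', (g : G) = eτ (ι (prj g)) := by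
    intro g
    rw [hιprj, hψ_apply, ContinuousMulEquiv.apply_symm_apply]
  -- §C  The block embedding `s_B : B →* M′`, `s_B b = e_{τ₀} (ι (b, 1))`.
  let j : ↥(unitaryGroupOfForm (starRingEnd ℂ) ((Matrix.diagonal ![(α ∘ τ₀) 0, (α ∘ τ₀) 2]).map w₀.1.embedding)) →* G :=
    (eτ : ↥(unitaryGroupOfForm (starRingEnd ℂ) ((Matrix.diagonal (α ∘ τ₀)).map w₀.1.embedding)) →* G).comp (ι.comp (MonoidHom.inl _ _))
  have hj_apply : ∀ b, j b = eτ (ι (b, 1)) := fun _ => rfl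
  -- `b` commutes with the central `diag(z₀ 0, z₀ 2)` of `B`, so `ι(b, 1)` commutes with `d₀`
  have hb_comm : ∀ b : ↥(unitaryGroupOfForm (starRingEnd ℂ) ((Matrix.diagonal ![(α ∘ τ₀) 0, (α ∘ τ₀) 2]).map w₀.1.embedding)),
      ι (b, 1) * d₀ = d₀ * ι (b, 1) := by
    intro b
    rw [hd₀ι, ← map_mul, ← map_mul, Prod.mk_mul_mk, Prod.mk_mul_mk, one_mul, mul_one]
    congr 2
    apply Subtype.ext
    exact circleDiagonal_two_comm_of_eq (u := ![z₀ 0, z₀ 2]) (by exact hz02) (b : GL (Fin 2) ℂ)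
  have hj_mem : ∀ b, j b ∈ M' := by
    intro b
    rw [Subgroup.mem_centralizer_singleton_iff, hj_apply, hwall, ← map_mul, ← map_mul, hb_comm]
  let sB : ↥(unitaryGroupOfForm (starRingEnd ℂ) ((Matrix.diagonal ![(α ∘ τ₀) 0, (α ∘ τ₀) 2]).map w₀.1.embedding)) →* ↥M' := j.codRestrict M' hj_mem
  have hsB_coe : ∀ b, ((sB b : ↥M') : G) = j b := fun b => rfl
  -- `prj (s_B b) = (b, 1)`
  have hπsB : ∀ b, prj (sB b) = (b, 1) := by
    intro b
    apply e9.symm.injective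
    apply Subtype.ext
    rw [he9 (b, 1)]
    show ((e9.symm (e9 (ψ' (sB b))) : ↥(Subgroup.centralizer ({d₀} : Set _))) : _) = ι (b, 1)
    rw [ContinuousMulEquiv.symm_apply_apply]
    show ψ (sB b) = ι (b, 1)
    rw [hψ_apply, hsB_coe, hj_apply, ContinuousMulEquiv.symm_apply_apply]
  have hprBsB : ∀ b, prB (sB b) = b := by
    intro b; rw [hprB_apply, hπsB]
  -- §D  `s_B(b)` commutes with every `k ∈ ker π_B`.
  have hcommK : ∀ b, ∀ k : ↥M', prB k = 1 → sB b * k = k * sB b := by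
    intro b k hk
    apply Subtype.ext
    show ((sB b : ↥M') : G) * (k : G) = (k : G) * ((sB b : ↥M') : G)
    rw [hsB_coe, hj_apply, hcomp k]
    have hk' : prj k = (1, (prj k).2) := Prod.ext (by rw [← hprB_apply]; exact hk) rfl
    have hc := (commute_endoEmb_inl_inr (starRingEnd ℂ) (endoForm_archLocal_diagonal L (α ∘ τ₀) w₀) b (prj k).2).eq
    rw [hk', ← map_mul eτ, ← map_mul eτ, hc]
  -- §E  `K = ker π_B` and the isomorphism `e_M : M′ ≃ₜ* B × K`.
  let K : Subgroup ↥M' := prB.ker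
  have hK_mem : ∀ k : ↥M', k ∈ K ↔ prB k = 1 := fun k => MonoidHom.mem_ker
  have hsec : ∀ g : ↥M', (sB (prB g))⁻¹ * g ∈ K := by
    intro g; rw [hK_mem, map_mul, map_inv, hprBsB, inv_mul_cancel]
  have hprB_cont : Continuous prB := by
    have h1 : Continuous ψ := by
      show Continuous fun g : ↥M' => eτ.symm (g : G)
      exact eτ.symm.continuous.comp continuous_subtype_val
    have h2 : Continuous ψ' := h1.subtype_mk _
    exact continuous_fst.comp (e9.continuous.comp h2)
  have hsB_cont : Continuous sB := by
    have h1 : Continuous j := by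
      show Continuous fun b => eτ (ι (b, 1))
      exact eτ.continuous.comp ((continuous_endoEmb (starRingEnd ℂ) (endoForm_archLocal_diagonal L (α ∘ τ₀) w₀)).comp (continuous_id.prodMk continuous_const))
    exact h1.subtype_mk _
  let eM : ↥M' ≃* (↥(unitaryGroupOfForm (starRingEnd ℂ) ((Matrix.diagonal ![(α ∘ τ₀) 0, (α ∘ τ₀) 2]).map w₀.1.embedding)) × ↥K) :=
    { toFun := fun g => (prB g, ⟨(sB (prB g))⁻¹ * g, hsec g⟩)
      invFun := fun q => sB q.1 * (q.2 : ↥M')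
      left_inv := fun g => mul_inv_cancel_left _ _
      right_inv := fun q => by
        have h1 : prB (sB q.1 * (q.2 : ↥M')) = q.1 := by rw [map_mul, hprBsB, (hK_mem _).1 q.2.2, mul_one]
        refine Prod.ext h1 (Subtype.ext ?_)
        show (sB (prB (sB q.1 * (q.2 : ↥M'))))⁻¹ * (sB q.1 * (q.2 : ↥M')) = (q.2 : ↥M')
        rw [h1, inv_mul_cancel_left]
      map_mul' := fun g h => by
        refine Prod.ext (map_mul prB g h) (Subtype.ext ?_)
        show (sB (prB (g * h)))⁻¹ * (g * h) = ((sB (prB g))⁻¹ * g) * ((sB (prB h))⁻¹ * h)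
        have hc : sB (prB h) * ((sB (prB g))⁻¹ * g) = ((sB (prB g))⁻¹ * g) * sB (prB h) := hcommK (prB h) _ ((hK_mem _).1 (hsec g))
        have hc' : (sB (prB h))⁻¹ * ((sB (prB g))⁻¹ * g) = ((sB (prB g))⁻¹ * g) * (sB (prB h))⁻¹ := by
          rw [inv_mul_eq_iff_eq_mul, ← mul_assoc, hc, mul_inv_cancel_right]
        rw [map_mul, map_mul, _root_.mul_inv_rev]
        calc (sB (prB h))⁻¹ * (sB (prB g))⁻¹ * (g * h)
            = ((sB (prB h))⁻¹ * ((sB (prB g))⁻¹ * g)) * h := by simp only [mul_assoc]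
          _ = (((sB (prB g))⁻¹ * g) * (sB (prB h))⁻¹) * h := by rw [hc']
          _ = (sB (prB g))⁻¹ * g * ((sB (prB h))⁻¹ * h) := by simp only [mul_assoc] }
  have heM_cont : Continuous eM := by
    show Continuous fun g : ↥M' => (prB g, (⟨(sB (prB g))⁻¹ * g, hsec g⟩ : ↥K))
    exact hprB_cont.prodMk (((hsB_cont.comp hprB_cont).inv.mul continuous_id).subtype_mk _)
  have heM_symm_cont : Continuous eM.symm := by
    show Continuous fun q : ↥(unitaryGroupOfForm (starRingEnd ℂ) ((Matrix.diagonal ![(α ∘ τ₀) 0, (α ∘ τ₀) 2]).map w₀.1.embedding)) × ↥K =>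
      sB q.1 * (q.2 : ↥M')
    exact (hsB_cont.comp continuous_fst).mul (continuous_subtype_val.comp continuous_snd)
  let e : ↥M' ≃ₜ* (↥(unitaryGroupOfForm (starRingEnd ℂ) ((Matrix.diagonal ![(α ∘ τ₀) 0, (α ∘ τ₀) 2]).map w₀.1.embedding)) × ↥K) :=
    { eM with continuous_toFun := heM_cont, continuous_invFun := heM_symm_cont }
  -- §F  Torus bookkeeping (`T₀ = chartTorusGLoc`, the closure of the range of the local chart).
  -- the block of a chart point
  have htorus : ∀ cw : Fin 3 → ℝ, prj ⟨gprimeBlockAt L α w₀ S' cw, gprimeBlockAt_mem_centralizer L α S' w₀ x₀ cw⟩ =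
      (⟨circleDiagonal 2 ![Circle.exp (cw 0), Circle.exp (cw 2)], (circleDiagonal_blocks_mem L (α ∘ τ₀) w₀ (fun k => Circle.exp (cw k))).1⟩,
       ⟨circleDiagonal 1 ![Circle.exp (cw 1)], (circleDiagonal_blocks_mem L (α ∘ τ₀) w₀ (fun k => Circle.exp (cw k))).2⟩) := by
    intro cw
    apply e9.symm.injective
    apply Subtype.ext
    rw [he9, he9, hιprj, hψ_apply, ← hdι cw]
    show eτ.symm (gprimeBlockAt L α w₀ S' cw) = _
    rw [hblk cw]
    exact ContinuousMulEquiv.symm_apply_apply eτ _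
  -- elements of `K` are chart points: `K ≤ T₀`
  have hKT : ∀ k : ↥M', k ∈ K → (k : G) ∈ chartTorusGLoc L α w₀ S' := by
    intro k hk
    have hk1 : prB k = 1 := (hK_mem k).1 hk
    obtain ⟨θ, hθ⟩ := exists_coe_eq_circleDiagonal_one_of_mem L (a := (α ∘ τ₀) 1) (hα _) w₀ (prj k).2
    have hk' : prj k = (1, (prj k).2) := Prod.ext (by rw [← hprB_apply]; exact hk1) rfl
    have hz : ι (1, (prj k).2) =
        ⟨circleDiagonal 3 (fun i => Circle.exp ((![0, θ, 0] : Fin 3 → ℝ) i)), circleDiagonal_mem_archLocal_diagonal L 3 (α ∘ τ₀) w₀ _⟩ := by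
      rw [hdι (![0, θ, 0] : Fin 3 → ℝ)]
      congr 1
      refine Prod.ext (Subtype.ext ?_) (Subtype.ext ?_)
      · show ((1 : ↥(unitaryGroupOfForm (starRingEnd ℂ) ((Matrix.diagonal ![(α ∘ τ₀) 0, (α ∘ τ₀) 2]).map w₀.1.embedding))) : GL (Fin 2) ℂ) =
          circleDiagonal 2 ![Circle.exp ((![0, θ, 0] : Fin 3 → ℝ) 0), Circle.exp ((![0, θ, 0] : Fin 3 → ℝ) 2)]
        have h0 : (![0, θ, 0] : Fin 3 → ℝ) 0 = 0 := rfl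
        have h2 : (![0, θ, 0] : Fin 3 → ℝ) 2 = 0 := rfl
        rw [h0, h2, Circle.exp_zero]
        have h11 : (![(1 : Circle), 1] : Fin 2 → Circle) = 1 := by funext i; fin_cases i <;> rfl
        rw [h11, map_one]
        rfl
      · show (((prj k).2 : ↥(unitaryGroupOfForm (starRingEnd ℂ) ((Matrix.diagonal ![(α ∘ τ₀) 1]).map w₀.1.embedding))) : GL (Fin 1) ℂ) =
          circleDiagonal 1 ![Circle.exp ((![0, θ, 0] : Fin 3 → ℝ) 1)]
        apply Units.ext
        rw [hθ, coe_circleDiagonal]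
        ext i j
        fin_cases i; fin_cases j
        simp [Circle.coe_exp]
    rw [hcomp k, hk', hz, ← hblk]
    exact gprimeBlockAt_mem_chartTorusGLoc L α w₀ S' _
  -- the chart torus, read through `π_B`
  have hM'closed : IsClosed ((M' : Subgroup G) : Set G) := by
    have h : ((M' : Subgroup G) : Set G) = {g : G | g * gprimeBlockAt L α w₀ S' x₀ = gprimeBlockAt L α w₀ S' x₀ * g} := by
      ext g; exact Subgroup.mem_centralizer_singleton_iff
    rw [h]
    exact isClosed_eq (continuous_id.mul continuous_const) (continuous_const.mul continuous_id)
  have hiff : ∀ g : ↥M', (g : G) ∈ chartTorusGLoc L α w₀ S' ↔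
      ((prB g : ↥(unitaryGroupOfForm (starRingEnd ℂ) ((Matrix.diagonal ![(α ∘ τ₀) 0, (α ∘ τ₀) 2]).map w₀.1.embedding))) : GL (Fin 2) ℂ) ∈
        Set.range (circleDiagonal 2) := by
    intro g
    constructor
    · intro hg
      -- the closed set `D = {g ∈ M′ | π_B g unit diagonal}` pushed into `G` contains the chart points, hence their closure `T₀`
      have hD : IsClosed {g : ↥M' | ((prB g : ↥(unitaryGroupOfForm (starRingEnd ℂ) ((Matrix.diagonal ![(α ∘ τ₀) 0, (α ∘ τ₀) 2]).map w₀.1.embedding))) :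
          GL (Fin 2) ℂ) ∈ Set.range (circleDiagonal 2)} :=
        ((isCompact_range (continuous_circleDiagonal 2)).isClosed).preimage (continuous_subtype_val.comp hprB_cont)
      have hE : IsClosed (((↑) : ↥M' → G) '' {g : ↥M' | ((prB g : ↥(unitaryGroupOfForm (starRingEnd ℂ) ((Matrix.diagonal ![(α ∘ τ₀) 0, (α ∘ τ₀) 2]).map w₀.1.embedding))) :
          GL (Fin 2) ℂ) ∈ Set.range (circleDiagonal 2)}) :=
        hM'closed.isClosedEmbedding_subtypeVal.isClosedMap _ hD
      have hsub : ((gprimeBlockAtHom L α w₀ S').range : Set G) ⊆ ((↑) : ↥M' → G) '' {g : ↥M' |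
          ((prB g : ↥(unitaryGroupOfForm (starRingEnd ℂ) ((Matrix.diagonal ![(α ∘ τ₀) 0, (α ∘ τ₀) 2]).map w₀.1.embedding))) : GL (Fin 2) ℂ) ∈
            Set.range (circleDiagonal 2)} := by
        rintro _ ⟨c, rfl⟩
        refine ⟨⟨gprimeBlockAt L α w₀ S' (Multiplicative.toAdd c), gprimeBlockAt_mem_centralizer L α S' w₀ x₀ _⟩,
          ⟨![Circle.exp ((Multiplicative.toAdd c) 0), Circle.exp ((Multiplicative.toAdd c) 2)], ?_⟩, rfl⟩
        show _ = ((prj _).1 : GL (Fin 2) ℂ)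
        rw [htorus]
      have hcl : (chartTorusGLoc L α w₀ S' : Set G) ⊆ ((↑) : ↥M' → G) '' {g : ↥M' |
          ((prB g : ↥(unitaryGroupOfForm (starRingEnd ℂ) ((Matrix.diagonal ![(α ∘ τ₀) 0, (α ∘ τ₀) 2]).map w₀.1.embedding))) : GL (Fin 2) ℂ) ∈
            Set.range (circleDiagonal 2)} := by
        show ((gprimeBlockAtHom L α w₀ S').range.topologicalClosure : Set G) ⊆ _
        rw [Subgroup.topologicalClosure_coe]
        exact closure_minimal hsub hE
      obtain ⟨g', hg', hgg'⟩ := hcl hg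
      have : g' = g := Subtype.ext hgg'
      rw [← this]
      exact hg'
    · rintro ⟨u, hu⟩
      -- `g = s_B(π_B g) · k` with `k ∈ K ≤ T₀` and `s_B(π_B g)` a chart point
      have hg : (g : G) = ((sB (prB g) : ↥M') : G) * (((sB (prB g))⁻¹ * g : ↥M') : G) := by
        rw [← Subgroup.coe_mul, mul_inv_cancel_left]
      rw [hg]
      refine Subgroup.mul_mem _ ?_ (hKT _ (hsec g))
      rw [hsB_coe, hj_apply]
      obtain ⟨θ₀, hθ₀⟩ := Circle.exp_surjective (u 0)
      obtain ⟨θ₁, hθ₁⟩ := Circle.exp_surjective (u 1)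
      have hz : ι (prB g, 1) =
          ⟨circleDiagonal 3 (fun i => Circle.exp ((![θ₀, 0, θ₁] : Fin 3 → ℝ) i)), circleDiagonal_mem_archLocal_diagonal L 3 (α ∘ τ₀) w₀ _⟩ := by
        rw [hdι (![θ₀, 0, θ₁] : Fin 3 → ℝ)]
        congr 1
        refine Prod.ext (Subtype.ext ?_) (Subtype.ext ?_)
        · show ((prB g : ↥(unitaryGroupOfForm (starRingEnd ℂ) ((Matrix.diagonal ![(α ∘ τ₀) 0, (α ∘ τ₀) 2]).map w₀.1.embedding))) : GL (Fin 2) ℂ) =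
            circleDiagonal 2 ![Circle.exp ((![θ₀, 0, θ₁] : Fin 3 → ℝ) 0), Circle.exp ((![θ₀, 0, θ₁] : Fin 3 → ℝ) 2)]
          rw [← hu]
          have h0 : (![θ₀, 0, θ₁] : Fin 3 → ℝ) 0 = θ₀ := rfl
          have h2 : (![θ₀, 0, θ₁] : Fin 3 → ℝ) 2 = θ₁ := rfl
          rw [h0, h2, hθ₀, hθ₁]
          congr 1
          funext i; fin_cases i <;> rfl
        · show ((1 : ↥(unitaryGroupOfForm (starRingEnd ℂ) ((Matrix.diagonal ![(α ∘ τ₀) 1]).map w₀.1.embedding))) : GL (Fin 1) ℂ) =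
            circleDiagonal 1 ![Circle.exp ((![θ₀, 0, θ₁] : Fin 3 → ℝ) 1)]
          have h1 : (![θ₀, 0, θ₁] : Fin 3 → ℝ) 1 = 0 := rfl
          rw [h1, Circle.exp_zero]
          have h11 : (![(1 : Circle)] : Fin 1 → Circle) = 1 := by funext i; fin_cases i; rfl
          rw [h11, map_one]
          rfl
      rw [hz, ← hblk]
      exact gprimeBlockAt_mem_chartTorusGLoc L α w₀ S' _
  -- the `K`-component of a chart point: zero the block slots
  have hsnd : ∀ cw : Fin 3 → ℝ,
      (((sB (prB ⟨gprimeBlockAt L α w₀ S' cw, gprimeBlockAt_mem_centralizer L α S' w₀ x₀ cw⟩))⁻¹ *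
          ⟨gprimeBlockAt L α w₀ S' cw, gprimeBlockAt_mem_centralizer L α S' w₀ x₀ cw⟩ : ↥M') : G) =
        gprimeBlockAt L α w₀ S' ![0, cw 1, 0] := by
    intro cw
    have hprod : (⟨gprimeBlockAt L α w₀ S' cw, gprimeBlockAt_mem_centralizer L α S' w₀ x₀ cw⟩ : ↥M') =
        sB (prB ⟨gprimeBlockAt L α w₀ S' cw, gprimeBlockAt_mem_centralizer L α S' w₀ x₀ cw⟩) *
          ⟨gprimeBlockAt L α w₀ S' ![0, cw 1, 0], gprimeBlockAt_mem_centralizer L α S' w₀ x₀ _⟩ := by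
      apply Subtype.ext
      show gprimeBlockAt L α w₀ S' cw = j (prB ⟨gprimeBlockAt L α w₀ S' cw, _⟩) * gprimeBlockAt L α w₀ S' ![0, cw 1, 0]
      rw [hj_apply, hprB_apply, htorus, hblk cw, hblk (![0, cw 1, 0] : Fin 3 → ℝ), ← map_mul eτ]
      congr 1
      rw [hdι cw, hdι (![0, cw 1, 0] : Fin 3 → ℝ), ← map_mul ι]
      congr 1
      refine Prod.ext (Subtype.ext ?_) (Subtype.ext ?_)
      · show circleDiagonal 2 ![Circle.exp (cw 0), Circle.exp (cw 2)] =
          circleDiagonal 2 ![Circle.exp (cw 0), Circle.exp (cw 2)] * circleDiagonal 2 ![Circle.exp ((![0, cw 1, 0] : Fin 3 → ℝ) 0), Circle.exp ((![0, cw 1, 0] : Fin 3 → ℝ) 2)]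
        have h0 : (![0, cw 1, 0] : Fin 3 → ℝ) 0 = 0 := rfl
        have h2 : (![0, cw 1, 0] : Fin 3 → ℝ) 2 = 0 := rfl
        rw [h0, h2, Circle.exp_zero]
        have h11 : (![(1 : Circle), 1] : Fin 2 → Circle) = 1 := by funext i; fin_cases i <;> rfl
        rw [h11, map_one, mul_one]
      · show circleDiagonal 1 ![Circle.exp (cw 1)] = 1 * circleDiagonal 1 ![Circle.exp ((![0, cw 1, 0] : Fin 3 → ℝ) 1)]
        rw [one_mul]
        rfl
    calc (((sB (prB ⟨gprimeBlockAt L α w₀ S' cw, gprimeBlockAt_mem_centralizer L α S' w₀ x₀ cw⟩))⁻¹ *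
            ⟨gprimeBlockAt L α w₀ S' cw, gprimeBlockAt_mem_centralizer L α S' w₀ x₀ cw⟩ : ↥M') : G)
        = (((sB (prB ⟨gprimeBlockAt L α w₀ S' cw, gprimeBlockAt_mem_centralizer L α S' w₀ x₀ cw⟩))⁻¹ *
            (sB (prB ⟨gprimeBlockAt L α w₀ S' cw, gprimeBlockAt_mem_centralizer L α S' w₀ x₀ cw⟩) *
              ⟨gprimeBlockAt L α w₀ S' ![0, cw 1, 0], gprimeBlockAt_mem_centralizer L α S' w₀ x₀ _⟩) : ↥M') : G) := by rw [← hprod]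
      _ = gprimeBlockAt L α w₀ S' ![0, cw 1, 0] := by rw [inv_mul_cancel_left]
  -- §G  Assembly.
  refine ⟨K, e, ?_, hKT, ?_, hiff, ?_, hsnd, ?_, ?_, ?_⟩
  · -- `K` is closed
    show IsClosed ((prB.ker : Subgroup ↥M') : Set ↥M')
    rw [MonoidHom.coe_ker]
    exact isClosed_singleton.preimage hprB_cont
  · -- `K` is commutative (it sits in the abelian `T₀`)
    intro k₁ hk₁ k₂ hk₂
    have h := chartTorusGLoc_mul_comm L α w₀ S' ⟨(k₁ : G), hKT k₁ hk₁⟩ ⟨(k₂ : G), hKT k₂ hk₂⟩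
    have h' : (k₁ : G) * (k₂ : G) = (k₂ : G) * (k₁ : G) := congrArg Subtype.val h
    exact Subtype.ext h'
  · -- the block of a chart point
    intro cw
    show (((prj ⟨gprimeBlockAt L α w₀ S' cw, gprimeBlockAt_mem_centralizer L α S' w₀ x₀ cw⟩).1 :
        ↥(unitaryGroupOfForm (starRingEnd ℂ) ((Matrix.diagonal ![(α ∘ τ₀) 0, (α ∘ τ₀) 2]).map w₀.1.embedding))) : GL (Fin 2) ℂ) =
      circleDiagonal 2 ![Circle.exp (cw 0), Circle.exp (cw 2)]
    rw [htorus]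
  · -- `e(T₀ ∩ M′) = A × ⊤` as subgroups of `B × K`
    ext q
    simp only [Subgroup.mem_map, Subgroup.mem_subgroupOf, Subgroup.mem_prod, Subgroup.mem_top, and_true, MonoidHom.mem_range,
      MonoidHom.coe_coe]
    constructor
    · rintro ⟨g, hg, rfl⟩
      obtain ⟨u, hu⟩ := (hiff g).1 hg
      exact ⟨u, Subtype.ext hu⟩
    · rintro ⟨u, hu⟩
      refine ⟨e.symm q, (hiff _).2 ⟨u, ?_⟩, e.apply_symm_apply q⟩
      have h1 : prB (e.symm q) = q.1 := by
        show (e (e.symm q)).1 = q.1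
        rw [e.apply_symm_apply]
      rw [h1, ← hu]
      rfl
  · -- [8] `e⁻¹ (b, 1) = s_B b = e_{τ₀} (ι (b, 1))`
    intro b
    show (((sB b * ((1 : ↥K) : ↥M')) : ↥M') : G) = _
    rw [Subgroup.coe_one, mul_one, hsB_coe, hj_apply]
    rfl
  · -- [10] `e k = (1, k)` on `K`
    intro k hk
    have hk1 : prB k = 1 := (hK_mem k).1 hk
    refine Prod.ext hk1 (Subtype.ext ?_)
    show (sB (prB k))⁻¹ * k = k
    rw [hk1, map_one, inv_one, one_mul]

end LocalUnfold

end Literature.NumberTheory.Automorphic.UnitaryGroup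

namespace Literature.NumberTheory.Rogawski1990

open Literature.NumberTheory.Automorphic Literature.NumberTheory.Automorphic.UnitaryGroup Literature.NumberTheory.Automorphic.ArchCartan

/-! ## §2 Harish-Chandra's compactness at the place `w₀`, ACROSS the wall, on a ball of coordinates (group level) -/

section Box

variable (L : Type) [Field L] [NumberField L] [IsCMField L] (α : Fin 3 → L)
  (S : Finset {w : InfinitePlace L // IsComplex w}) (w₀ : {w : InfinitePlace L // IsComplex w})

omit [NumberField L] [IsCMField L] in
/-- Three pairwise distinct values on `Fin 3` give an injective function. [folklore] -/
private theorem injective_fin_three_of_ne {X : Type*} {f : Fin 3 → X} (h01 : f 0 ≠ f 1) (h02 : f 0 ≠ f 2) (h12 : f 1 ≠ f 2) : Function.Injective f := by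
  intro i j h
  fin_cases i <;> fin_cases j
  · rfl
  · exact absurd h h01
  · exact absurd h h02
  · exact absurd h.symm h01
  · rfl
  · exact absurd h h12
  · exact absurd h.symm h02
  · exact absurd h.symm h12
  · rfl

omit [NumberField L] [IsCMField L] in
/-- **ONE COMPACT `C″ ⊆ U(α)_{w₀}` FOR ALL COORDINATES NEAR A WALL POINT** (Rogawski's Lemma 4.12.1 «for all `x` near `1` in `M`», one place): `w₀ ∉ S` (compact chart), `x₀` with
`e^{ix₀1} ≠ e^{ix₀0} = e^{ix₀2}`, `C` compact.  There are a compact `C″` and an open `V ∋ x₀` on which the middle slot stays simple (`e^{icw1} ≠ e^{icw0}, e^{icw2}`) such that for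
EVERY `cw ∈ V`: `y · γ₀(cw) · y⁻¹ ∈ C ⇒ y ∈ C″ · Z(γ₀(x₀))` — ★ D1c `uniformlyProper_gprimeBlock_cpt_of_ne` modulo `Z(γ₀(x₀)) ≥ Stab(e_{τ₀1})` on a compact ball, lifted to the group.
[cite: Rogawski1990, §4.12 Lemma 4.12.1 p. 66; §8.2 pp. 122–123] [cite: HarishChandra1970, Part I §3 Lemma 22] -/
theorem exists_isCompact_mul_centralizer_ball_gprimeBlockAt (hα : ∀ i, α i ≠ 0) (hreal₀ : ∀ i : Fin 3, (w₀.1.embedding (α i)).im = 0) (hw₀ : w₀ ∉ S)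
    {x₀ : Fin 3 → ℝ} (hx02 : x₀ 0 = x₀ 2) (hx1 : Circle.exp (x₀ 1) ≠ Circle.exp (x₀ 0))
    [LocallyCompactSpace ↥(archLocal L 3 (Matrix.diagonal α) w₀)]
    {C : Set ↥(archLocal L 3 (Matrix.diagonal α) w₀)} (hC : IsCompact C) :
    ∃ (C'' : Set ↥(archLocal L 3 (Matrix.diagonal α) w₀)) (V : Set (Fin 3 → ℝ)), IsCompact C'' ∧ IsOpen V ∧ x₀ ∈ V ∧
      (∀ cw ∈ V, Circle.exp (cw 1) ≠ Circle.exp (cw 0) ∧ Circle.exp (cw 1) ≠ Circle.exp (cw 2)) ∧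
      ∀ cw ∈ V, ∀ y : ↥(archLocal L 3 (Matrix.diagonal α) w₀), y * gprimeBlockAt L α w₀ S cw * y⁻¹ ∈ C →
        y ∈ C'' * ((Subgroup.centralizer ({gprimeBlockAt L α w₀ S x₀} : Set ↥(archLocal L 3 (Matrix.diagonal α) w₀))) : Set ↥(archLocal L 3 (Matrix.diagonal α) w₀)) := by
  have hw : ¬ (w₀ ∈ S ∧ w₀ ∈ splitChartPlaces L α) := fun h => hw₀ h.1
  -- the open set where the middle slot is simple
  have hWo : IsOpen {cw : Fin 3 → ℝ | ∀ j : Fin 3, j ≠ 1 → Circle.exp (cw 1) ≠ Circle.exp (cw j)} := by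
    have h : {cw : Fin 3 → ℝ | ∀ j : Fin 3, j ≠ 1 → Circle.exp (cw 1) ≠ Circle.exp (cw j)} =
        {cw | Circle.exp (cw 1) ≠ Circle.exp (cw 0)} ∩ {cw | Circle.exp (cw 1) ≠ Circle.exp (cw 2)} := by
      ext cw
      simp only [Set.mem_setOf_eq, Set.mem_inter_iff]
      constructor
      · intro h; exact ⟨h 0 (by decide), h 2 (by decide)⟩
      · rintro ⟨h0, h2⟩ j hj
        fin_cases j
        · exact h0
        · exact absurd rfl hj
        · exact h2
    rw [h]
    exact (isOpen_ne_fun (Circle.exp.continuous.comp (continuous_apply 1)) (Circle.exp.continuous.comp (continuous_apply 0))).inter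
      (isOpen_ne_fun (Circle.exp.continuous.comp (continuous_apply 1)) (Circle.exp.continuous.comp (continuous_apply 2)))
  have hx₀W : x₀ ∈ {cw : Fin 3 → ℝ | ∀ j : Fin 3, j ≠ 1 → Circle.exp (cw 1) ≠ Circle.exp (cw j)} := by
    intro j hj
    fin_cases j
    · exact hx1
    · exact absurd rfl hj
    · show Circle.exp (x₀ 1) ≠ Circle.exp (x₀ 2)
      rw [← hx02]; exact hx1
  obtain ⟨ε, hε, hball⟩ := Metric.isOpen_iff.1 hWo x₀ hx₀W
  have hKc : IsCompact (Metric.closedBall x₀ (ε / 2)) := isCompact_closedBall x₀ (ε / 2)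
  have hKW : Metric.closedBall x₀ (ε / 2) ⊆ {cw : Fin 3 → ℝ | ∀ j : Fin 3, j ≠ 1 → Circle.exp (cw 1) ≠ Circle.exp (cw j)} :=
    (Metric.closedBall_subset_ball (by linarith)).trans hball
  -- `Stab(e_{τ₀1}) ≤ Z(γ₀(x₀))` (the two other slots lie on the wall at `x₀`)
  have hwall : ∀ j j' : Fin 3, j ≠ 1 → j' ≠ 1 → Circle.exp (x₀ j) = Circle.exp (x₀ j') := by
    have hkey : ∀ j : Fin 3, j ≠ 1 → Circle.exp (x₀ j) = Circle.exp (x₀ 0) := by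
      intro j hj
      fin_cases j
      · rfl
      · exact absurd rfl hj
      · exact congrArg Circle.exp hx02.symm
    exact fun j j' hj hj' => (hkey j hj).trans (hkey j' hj').symm
  have hM : MulAction.stabilizer ↥(archLocal L 3 (Matrix.diagonal α) w₀) (Pi.single (lineOf (formSign L α w₀) 1) (1 : ℂ) : Fin 3 → ℂ) ≤
      Subgroup.centralizer ({gprimeBlockAt L α w₀ S x₀} : Set ↥(archLocal L 3 (Matrix.diagonal α) w₀)) :=
    stabilizer_single_le_centralizer_gprimeBlock_of_wall L α S hα hreal₀ hw 1 (fun _ => x₀) hwall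
  obtain ⟨𝒦, h𝒦, hmem𝒦⟩ := uniformlyProper_gprimeBlock_cpt_of_ne L α S hα hreal₀ hw 1 _ hM _ hKW hKc C hC
  obtain ⟨C'', hC'', hsub⟩ := Literature.MeasureTheory.Group.exists_isCompact_image_mk_superset
    (Subgroup.centralizer ({gprimeBlockAt L α w₀ S x₀} : Set ↥(archLocal L 3 (Matrix.diagonal α) w₀))) h𝒦
  refine ⟨C'', Metric.ball x₀ (ε / 2), hC'', Metric.isOpen_ball, Metric.mem_ball_self (half_pos hε), fun cw hcw => ?_, fun cw hcw y hy => ?_⟩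
  · have h := hKW (Metric.ball_subset_closedBall hcw)
    exact ⟨h 0 (by decide), h 2 (by decide)⟩
  · obtain ⟨a, ha, hay⟩ := hsub (hmem𝒦 _ (Metric.ball_subset_closedBall hcw) y hy)
    rw [QuotientGroup.eq] at hay
    exact ⟨a, ha, a⁻¹ * y, hay, by group⟩

end Box

/-! ## §3 (aM-SMOOTH) with parameters: the `β`-averaged conjugate of a smooth FAMILY is jointly smooth -/

section Descended

variable {G₀ : Subgroup (GL (Fin 3) ℂ)} [MeasurableSpace ↥G₀] [BorelSpace ↥G₀] (ν₀ : Measure ↥G₀) [IsFiniteMeasureOnCompacts ν₀]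
  {P : Type*} [NormedAddCommGroup P] [NormedSpace ℝ P] [FiniteDimensional ℝ P]
  {E : Type*} [NormedAddCommGroup E] [NormedSpace ℝ E] [CompleteSpace E]

/-- **THE `β`-AVERAGED CONJUGATE OF A SMOOTH AMBIENT FAMILY IS JOINTLY SMOOTH**: for `Ξ : P × M₃(ℂ) → E` smooth and a continuous compactly supported cut-off `β` on a closed
subgroup `G₀ ≤ GL₃(ℂ)`, `(y, X) ↦ ∫_{G₀} β(x) • Ξ(y, ↑↑x · X · ↑↑x⁻¹) dν₀(x)` is `C^∞` on ALL of `P × M₃(ℂ)` (Hörmander: the integrand `b • Ξ(y, A X C)` is smooth in `((b, A, C), (y, X))`,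
read at the continuous datum `(β x, ↑↑x, ↑↑x⁻¹)`, and vanishes for `x ∉ tsupport β`) — the parametric twin of ★ `contDiff_integral_smul_comp_conj`.
[cite: HormanderALPDO1, Thm. 1.1.9] [cite: DeitmarEchterhoff2014, Lemma 9.3.3] [cite: Rogawski1990, §8.2 p. 114] -/
theorem contDiff_integral_smul_comp_conj_param (Ξ : P × Matrix (Fin 3) (Fin 3) ℂ → E) (hΞ : ContDiff ℝ ∞ Ξ)
    (β : ↥G₀ → ℝ) (hβc : Continuous β) (hβs : HasCompactSupport β) :
    ContDiff ℝ ∞ fun q : P × Matrix (Fin 3) (Fin 3) ℂ =>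
      ∫ x, β x • Ξ (q.1, ((x : GL (Fin 3) ℂ) : Matrix (Fin 3) (Fin 3) ℂ) * q.2 * (((x⁻¹ : ↥G₀) : GL (Fin 3) ℂ) : Matrix (Fin 3) (Fin 3) ℂ)) ∂ν₀ := by
  let Q := ℝ × Matrix (Fin 3) (Fin 3) ℂ × Matrix (Fin 3) (Fin 3) ℂ
  obtain ⟨Ψ, hΨ⟩ : ∃ Ψ : Q × (P × Matrix (Fin 3) (Fin 3) ℂ) → E, Ψ = fun w => w.1.1 • Ξ (w.2.1, w.1.2.1 * w.2.2 * w.1.2.2) := ⟨_, rfl⟩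
  have hΨs : ContDiff ℝ ∞ Ψ := by
    rw [hΨ]
    refine (contDiff_fst.comp contDiff_fst).smul (hΞ.comp ?_)
    exact (contDiff_fst.comp contDiff_snd).prodMk
      (((contDiff_fst.comp (contDiff_snd.comp contDiff_fst)).mul (contDiff_snd.comp contDiff_snd)).mul (contDiff_snd.comp (contDiff_snd.comp contDiff_fst)))
  obtain ⟨y, hy⟩ : ∃ y : ↥G₀ → Q, y = fun x =>
      (β x, ((x : GL (Fin 3) ℂ) : Matrix (Fin 3) (Fin 3) ℂ), (((x⁻¹ : ↥G₀) : GL (Fin 3) ℂ) : Matrix (Fin 3) (Fin 3) ℂ)) := ⟨_, rfl⟩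
  have hcoe : Continuous fun x : ↥G₀ => ((x : GL (Fin 3) ℂ) : Matrix (Fin 3) (Fin 3) ℂ) := Units.continuous_val.comp continuous_subtype_val
  have hyc : Continuous y := by
    rw [hy]
    exact hβc.prodMk (hcoe.prodMk (hcoe.comp continuous_inv))
  have hEq : (fun q : P × Matrix (Fin 3) (Fin 3) ℂ =>
      ∫ x, β x • Ξ (q.1, ((x : GL (Fin 3) ℂ) : Matrix (Fin 3) (Fin 3) ℂ) * q.2 * (((x⁻¹ : ↥G₀) : GL (Fin 3) ℂ) : Matrix (Fin 3) (Fin 3) ℂ)) ∂ν₀) =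
      fun q => ∫ x, Ψ (y x, q) ∂ν₀ := by
    rw [hΨ, hy]
  rw [hEq]
  refine contDiff_iff_contDiffAt.2 fun q₀ => ?_
  refine Literature.Analysis.Calculus.contDiffAt_integral_comp_of_contDiff_of_support ν₀ Ψ hΨs y hyc q₀ hβs Filter.univ_mem ?_
  intro x hx q _
  rw [hΨ, hy]
  simp only [image_eq_zero_of_notMem_tsupport hx, zero_smul]

end Descended

/-! ## §4 The head: the one-place parametric wall descent -/

section Local

variable (L : Type) [Field L] [NumberField L] [IsCMField L] (α : Fin 3 → L)
  (S : Finset {w : InfinitePlace L // IsComplex w}) (w₀ : {w : InfinitePlace L // IsComplex w})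
  [MeasurableSpace ↥(archLocal L 3 (Matrix.diagonal α) w₀)] [BorelSpace ↥(archLocal L 3 (Matrix.diagonal α) w₀)]
  -- ★ `locallyCompactSpace_archLocal_three` ∕ ★ `secondCountableTopology_archLocal_three` (theorems, not instances: supplied by the consumer with `haveI`, as in ★ (A1))
  [LocallyCompactSpace ↥(archLocal L 3 (Matrix.diagonal α) w₀)] [SecondCountableTopology ↥(archLocal L 3 (Matrix.diagonal α) w₀)]
  (ν₀ : Measure ↥(archLocal L 3 (Matrix.diagonal α) w₀)) [ν₀.IsHaarMeasure] [ν₀.IsMulRightInvariant]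
  (t₀ : Measure ↥(chartTorusGLoc L α w₀ S)) [t₀.IsHaarMeasure] [t₀.IsInvInvariant]
  [MeasurableSpace (↥(archLocal L 3 (Matrix.diagonal α) w₀) ⧸ chartTorusGLoc L α w₀ S)]
  [BorelSpace (↥(archLocal L 3 (Matrix.diagonal α) w₀) ⧸ chartTorusGLoc L α w₀ S)]

set_option maxHeartbeats 1600000 in
/-- **(H-core) L1 — THE ONE-PLACE PARAMETRIC BLOCK STEP.**  House frame at the place `w₀` (real weights, `w₀ ∈ splitChartPlaces`, compact chart `w₀ ∉ S`), any Haar data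
`ν₀` (right-invariant) on `G₀ = U(α)_{w₀}`, `t₀` (inversion-invariant) on the local chart torus `T₀`, any Haar `μ₀` on `U(J)`; a base wall point `x₀` (`x₀ 0 = x₀ 2`,
`e^{ix₀1} ≠ e^{ix₀0}`); a smooth FAMILY `B(y)(g) = Ξ(y, ↑↑g)` of test functions on `G₀`, `Ξ` smooth on `P × M₃(ℂ)`, with ONE compact `g`-support near the base parameter `y₀`.  THEN
there are `K ≠ 0`, open `O ∋ y₀`, `V ∋ x₀` and a JOINTLY SMOOTH `f : (P × ℝ³) × M₂(ℂ) → ℂ`, compactly supported in the matrix variable uniformly, depending on `cw` only through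
`(0, cw1, 0)`, such that for every `y ∈ O` and every REGULAR `cw ∈ V`:
**`∫_{G₀ ⧸ T₀} B(y)(q · γ₀(cw) · q⁻¹) d(ν₀ ∕ t₀) = K · ∫_{U(J)} f((y, cw), ↑↑(h · P diag(e^{icw0}, e^{icw2}) P⁻¹ · h⁻¹)) dμ₀(h)`** (`γ₀ = gprimeBlockAt α w₀ S`, `P = (1 1; 1 −1)`).
The one-place, parametric edition of ★ p851016 `exists_descent_box_chartOrbG`. [cite: Rogawski1990, §4.12 Lemma 4.12.1 p. 66; §8.2 pp. 119–124]
[cite: HarishChandra1970, Part I §3 Lemma 22] [cite: Shelstad1979, §4 Lemma 4.3 (p. 25)] [cite: HormanderALPDO1, Thm. 1.1.9] -/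
theorem exists_descent_box_local_param (hα : ∀ i, α i ≠ 0) (hreal₀ : ∀ i : Fin 3, (w₀.1.embedding (α i)).im = 0)
    {J : Matrix (Fin 2) (Fin 2) ℂ} (hJ : J = (StdForm.antidiagonal 2).over ℂ)
    [MeasurableSpace ↥(unitaryGroupOfForm (starRingEnd ℂ) J)] [BorelSpace ↥(unitaryGroupOfForm (starRingEnd ℂ) J)]
    [LocallyCompactSpace ↥(unitaryGroupOfForm (starRingEnd ℂ) J)] [SecondCountableTopology ↥(unitaryGroupOfForm (starRingEnd ℂ) J)]
    (μ₀ : Measure ↥(unitaryGroupOfForm (starRingEnd ℂ) J)) [μ₀.IsHaarMeasure] [μ₀.IsMulRightInvariant]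
    (hw₀ : w₀ ∉ S) (hwsp : w₀ ∈ splitChartPlaces L α)
    {x₀ : Fin 3 → ℝ} (hx02 : x₀ 0 = x₀ 2) (hx1 : Circle.exp (x₀ 1) ≠ Circle.exp (x₀ 0))
    {P : Type*} [NormedAddCommGroup P] [NormedSpace ℝ P] [FiniteDimensional ℝ P] (y₀ : P)
    (B : P → ↥(archLocal L 3 (Matrix.diagonal α) w₀) → ℂ) (Ξ : P × Matrix (Fin 3) (Fin 3) ℂ → ℂ) (hΞ : ContDiff ℝ ∞ Ξ)
    (hBΞ : ∀ y g, B y g = Ξ (y, ((g : GL (Fin 3) ℂ) : Matrix (Fin 3) (Fin 3) ℂ)))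
    (hBsupp : ∃ O ∈ 𝓝 y₀, ∃ C : Set ↥(archLocal L 3 (Matrix.diagonal α) w₀), IsCompact C ∧ ∀ y ∈ O, ∀ g ∉ C, B y g = 0) :
    ∃ (K : ℂ) (O : Set P) (V : Set (Fin 3 → ℝ)) (f : (P × (Fin 3 → ℝ)) × Matrix (Fin 2) (Fin 2) ℂ → ℂ),
      K ≠ 0 ∧ IsOpen O ∧ y₀ ∈ O ∧ IsOpen V ∧ x₀ ∈ V ∧ ContDiff ℝ ∞ f ∧
      (∃ C : Set (Matrix (Fin 2) (Fin 2) ℂ), IsCompact C ∧ ∀ y cw X, X ∉ C → f ((y, cw), X) = 0) ∧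
      (∀ y cw X, f ((y, cw), X) = f ((y, ![0, cw 1, 0]), X)) ∧
      ∀ y ∈ O, ∀ cw ∈ V, Circle.exp (cw 0) ≠ Circle.exp (cw 2) →
        ∫ q, descConj (gprimeBlockAt L α w₀ S cw) (chartTorusGLoc L α w₀ S) (forall_mem_chartTorusGLoc_comm L α w₀ S cw) (B y) q
            ∂(quotientMeasure (chartTorusGLoc L α w₀ S) t₀ (isClosed_chartTorusGLoc L α w₀ S) ν₀) =
          K * ∫ h : ↥(unitaryGroupOfForm (starRingEnd ℂ) J),
            f ((y, cw), (((h * ⟨Matrix.GeneralLinearGroup.mkOfDetNeZero !![(1 : ℂ), 1; 1, -1] det_cayleyTwo_ne_zero *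
                circleDiagonal 2 ![Circle.exp (cw 0), Circle.exp (cw 2)] *
                (Matrix.GeneralLinearGroup.mkOfDetNeZero !![(1 : ℂ), 1; 1, -1] det_cayleyTwo_ne_zero)⁻¹,
              cayley_conj_circleDiagonal_mem_of_eq_over hJ _⟩ * h⁻¹ : ↥(unitaryGroupOfForm (starRingEnd ℂ) J)) : GL (Fin 2) ℂ) : Matrix (Fin 2) (Fin 2) ℂ)) ∂μ₀ := by
  -- ### notation-free abbreviations used only in `have` types
  -- ### frame facts
  obtain ⟨hreal2, hsgn⟩ := blockWeights_of_mem_splitChartPlaces L α w₀ hwsp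
  have h02c : Circle.exp (x₀ 0) = Circle.exp (x₀ 2) := by rw [hx02]
  have h01 : Circle.exp (x₀ 0) ≠ Circle.exp (x₀ 1) := fun h => hx1 h.symm
  -- ### the family: continuity and ONE compact support near `y₀`
  obtain ⟨O₁, hO₁, C, hC, hBC⟩ := hBsupp
  obtain ⟨O, hOO₁, hOo, hy₀O⟩ := mem_nhds_iff.1 hO₁
  have hBc : ∀ y, Continuous (B y) := fun y => by
    have h : B y = fun g : ↥(archLocal L 3 (Matrix.diagonal α) w₀) => Ξ (y, ((g : GL (Fin 3) ℂ) : Matrix (Fin 3) (Fin 3) ℂ)) := funext fun g => hBΞ y g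
    rw [h]
    exact hΞ.continuous.comp (continuous_const.prodMk (Units.continuous_val.comp continuous_subtype_val))
  have hBts : ∀ y ∈ O, tsupport (B y) ⊆ C := fun y hy =>
    closure_minimal (fun g hg => by_contra fun hgC => hg (hBC y (hOO₁ hy) g hgC)) hC.isClosed
  have hBs : ∀ y ∈ O, HasCompactSupport (B y) := fun y hy => HasCompactSupport.of_support_subset_isCompact hC
    (fun g hg => by_contra fun hgC => hg (hBC y (hOO₁ hy) g hgC))
  -- ### LOCAL (M-UNFOLD) (§1): `e : Z(γ₀(x₀)) ≃ₜ* B × K₀` with clauses [4]–[10]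
  refine (exists_continuousMulEquiv_centralizer_gprimeBlockAt_wall_explicit L α S w₀ hα hw₀ x₀ h02c h01).elim fun K hK => hK.elim fun e he => ?_
  obtain ⟨hKc, hKsub, hKcomm, h4, h5, h6, hmapT, h8, h10⟩ := he
  -- ### (B-STD) package: `φ`, `e′`, `Ψ` (★ `exists_std_package`, generic in the group)
  refine (exists_std_package L α w₀ hJ hreal2 hsgn e _ _ hmapT).elim fun φ hφ => hφ.elim fun e' hY => hY.elim fun Ψ hZ => ?_
  have hφ := hZ.1
  have hval := hZ.2.1
  have he' := hZ.2.2.1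
  have hmem := hZ.2.2.2.2.1
  have hΨ := hZ.2.2.2.2.2.2
  -- ### the local chart torus sits inside `Z(γ₀(x₀))`
  have hT : chartTorusGLoc L α w₀ S ≤ Subgroup.centralizer ({gprimeBlockAt L α w₀ S x₀} : Set ↥(archLocal L 3 (Matrix.diagonal α) w₀)) :=
    chartTorusGLoc_le_centralizer L α w₀ S x₀
  -- ### instances on `Z(γ₀(x₀))`, its quotient, `K₀`, `U(J) ⧸ φ(A)`
  have hZc : IsClosed ((Subgroup.centralizer ({gprimeBlockAt L α w₀ S x₀} : Set ↥(archLocal L 3 (Matrix.diagonal α) w₀))) :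
      Set ↥(archLocal L 3 (Matrix.diagonal α) w₀)) := isClosed_centralizer_singleton_of_t2 _
  haveI : LocallyCompactSpace ↥(Subgroup.centralizer ({gprimeBlockAt L α w₀ S x₀} : Set ↥(archLocal L 3 (Matrix.diagonal α) w₀))) := hZc.isClosedEmbedding_subtypeVal.locallyCompactSpace
  haveI : SecondCountableTopology ↥(Subgroup.centralizer ({gprimeBlockAt L α w₀ S x₀} : Set ↥(archLocal L 3 (Matrix.diagonal α) w₀))) := TopologicalSpace.Subtype.secondCountableTopology _
  letI : MeasurableSpace (↥(Subgroup.centralizer ({gprimeBlockAt L α w₀ S x₀} : Set ↥(archLocal L 3 (Matrix.diagonal α) w₀))) ⧸ (chartTorusGLoc L α w₀ S).subgroupOf (Subgroup.centralizer ({gprimeBlockAt L α w₀ S x₀} : Set ↥(archLocal L 3 (Matrix.diagonal α) w₀)))) := borel _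
  haveI : BorelSpace (↥(Subgroup.centralizer ({gprimeBlockAt L α w₀ S x₀} : Set ↥(archLocal L 3 (Matrix.diagonal α) w₀))) ⧸ (chartTorusGLoc L α w₀ S).subgroupOf (Subgroup.centralizer ({gprimeBlockAt L α w₀ S x₀} : Set ↥(archLocal L 3 (Matrix.diagonal α) w₀)))) := ⟨rfl⟩
  haveI : LocallyCompactSpace ↥K := hKc.isClosedEmbedding_subtypeVal.locallyCompactSpace
  haveI : SecondCountableTopology ↥K := TopologicalSpace.Subtype.secondCountableTopology _
  letI : MeasurableSpace ↥K := borel _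
  haveI : BorelSpace ↥K := ⟨rfl⟩
  letI : MeasurableSpace (↥(unitaryGroupOfForm (starRingEnd ℂ) J) ⧸ Subgroup.map (φ : ↥(unitaryGroupOfForm (starRingEnd ℂ) ((Matrix.diagonal ![α (lineOf (formSign L α w₀) 0), α (lineOf (formSign L α w₀) 2)]).map w₀.1.embedding)) →* ↥(unitaryGroupOfForm (starRingEnd ℂ) J)) ((circleDiagonal 2).codRestrict (unitaryGroupOfForm (starRingEnd ℂ) ((Matrix.diagonal ![α (lineOf (formSign L α w₀) 0), α (lineOf (formSign L α w₀) 2)]).map w₀.1.embedding)) (circleDiagonal_mem_archLocal_diagonal L 2 ![α (lineOf (formSign L α w₀) 0), α (lineOf (formSign L α w₀) 2)] w₀)).range) := borel _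
  haveI : BorelSpace (↥(unitaryGroupOfForm (starRingEnd ℂ) J) ⧸ Subgroup.map (φ : ↥(unitaryGroupOfForm (starRingEnd ℂ) ((Matrix.diagonal ![α (lineOf (formSign L α w₀) 0), α (lineOf (formSign L α w₀) 2)]).map w₀.1.embedding)) →* ↥(unitaryGroupOfForm (starRingEnd ℂ) J)) ((circleDiagonal 2).codRestrict (unitaryGroupOfForm (starRingEnd ℂ) ((Matrix.diagonal ![α (lineOf (formSign L α w₀) 0), α (lineOf (formSign L α w₀) 2)]).map w₀.1.embedding)) (circleDiagonal_mem_archLocal_diagonal L 2 ![α (lineOf (formSign L α w₀) 0), α (lineOf (formSign L α w₀) 2)] w₀)).range) := ⟨rfl⟩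
  haveI : CompactSpace ↥(Subgroup.map (φ : ↥(unitaryGroupOfForm (starRingEnd ℂ) ((Matrix.diagonal ![α (lineOf (formSign L α w₀) 0), α (lineOf (formSign L α w₀) 2)]).map w₀.1.embedding)) →* ↥(unitaryGroupOfForm (starRingEnd ℂ) J)) ((circleDiagonal 2).codRestrict (unitaryGroupOfForm (starRingEnd ℂ) ((Matrix.diagonal ![α (lineOf (formSign L α w₀) 0), α (lineOf (formSign L α w₀) 2)]).map w₀.1.embedding)) (circleDiagonal_mem_archLocal_diagonal L 2 ![α (lineOf (formSign L α w₀) 0), α (lineOf (formSign L α w₀) 2)] w₀)).range) := isCompact_iff_compactSpace.mp (isCompact_map_circleDiagonal_range L α w₀ φ)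
  have hAcomm : ∀ a b : ↥(Subgroup.map (φ : ↥(unitaryGroupOfForm (starRingEnd ℂ) ((Matrix.diagonal ![α (lineOf (formSign L α w₀) 0), α (lineOf (formSign L α w₀) 2)]).map w₀.1.embedding)) →* ↥(unitaryGroupOfForm (starRingEnd ℂ) J)) ((circleDiagonal 2).codRestrict (unitaryGroupOfForm (starRingEnd ℂ) ((Matrix.diagonal ![α (lineOf (formSign L α w₀) 0), α (lineOf (formSign L α w₀) 2)]).map w₀.1.embedding)) (circleDiagonal_mem_archLocal_diagonal L 2 ![α (lineOf (formSign L α w₀) 0), α (lineOf (formSign L α w₀) 2)] w₀)).range), a * b = b * a := by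
    rintro ⟨_, ⟨x, ⟨u, rfl⟩, rfl⟩⟩ ⟨_, ⟨y, ⟨v, rfl⟩, rfl⟩⟩
    apply Subtype.ext
    show (φ : ↥(unitaryGroupOfForm (starRingEnd ℂ) ((Matrix.diagonal ![α (lineOf (formSign L α w₀) 0), α (lineOf (formSign L α w₀) 2)]).map w₀.1.embedding)) →* ↥(unitaryGroupOfForm (starRingEnd ℂ) J)) _ * (φ : ↥(unitaryGroupOfForm (starRingEnd ℂ) ((Matrix.diagonal ![α (lineOf (formSign L α w₀) 0), α (lineOf (formSign L α w₀) 2)]).map w₀.1.embedding)) →* ↥(unitaryGroupOfForm (starRingEnd ℂ) J)) _ =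
      (φ : ↥(unitaryGroupOfForm (starRingEnd ℂ) ((Matrix.diagonal ![α (lineOf (formSign L α w₀) 0), α (lineOf (formSign L α w₀) 2)]).map w₀.1.embedding)) →* ↥(unitaryGroupOfForm (starRingEnd ℂ) J)) _ * (φ : ↥(unitaryGroupOfForm (starRingEnd ℂ) ((Matrix.diagonal ![α (lineOf (formSign L α w₀) 0), α (lineOf (formSign L α w₀) 2)]).map w₀.1.embedding)) →* ↥(unitaryGroupOfForm (starRingEnd ℂ) J)) _
    rw [← map_mul, ← map_mul, ← map_mul, ← map_mul, mul_comm u v]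
  -- ### a right- and inversion-invariant Haar measure on `Z(γ₀(x₀))` (product decomposition)
  obtain ⟨νM, hνM1, hνM2, hνM3⟩ := (Subgroup.centralizer ({gprimeBlockAt L α w₀ S x₀} : Set ↥(archLocal L 3 (Matrix.diagonal α) w₀))).exists_isHaarMeasure_isMulRightInvariant_isInvInvariant_of_continuousMulEquiv_prod
    hZc K hKc hKcomm e' μ₀
  haveI := hνM1; haveI := hνM2; haveI := hνM3
  -- ### the descent scalar `κ`: `Ψ_*(νM ∕ t₀′) = κ • π_* μ₀` (★ `exists_smul_map_mk_of_block_compact`)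
  haveI : t₀.IsMulRightInvariant := isMulRightInvariant_of_isInvInvariant t₀
  haveI := isHaarMeasure_map_subgroupOfEquivOfLe_symm hT t₀
  haveI := isInvInvariant_map_subgroupOfEquivOfLe_symm hT t₀
  have hTc := isClosed_subgroupOf_of_isClosed _ (Subgroup.centralizer ({gprimeBlockAt L α w₀ S x₀} : Set ↥(archLocal L 3 (Matrix.diagonal α) w₀))) (isClosed_chartTorusGLoc L α w₀ S)
  have hAcpt : IsCompact ((Subgroup.map (φ : ↥(unitaryGroupOfForm (starRingEnd ℂ) ((Matrix.diagonal ![α (lineOf (formSign L α w₀) 0), α (lineOf (formSign L α w₀) 2)]).map w₀.1.embedding)) →* ↥(unitaryGroupOfForm (starRingEnd ℂ) J)) ((circleDiagonal 2).codRestrict (unitaryGroupOfForm (starRingEnd ℂ) ((Matrix.diagonal ![α (lineOf (formSign L α w₀) 0), α (lineOf (formSign L α w₀) 2)]).map w₀.1.embedding)) (circleDiagonal_mem_archLocal_diagonal L 2 ![α (lineOf (formSign L α w₀) 0), α (lineOf (formSign L α w₀) 2)] w₀)).range) :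
      Set ↥(unitaryGroupOfForm (starRingEnd ℂ) J)) := isCompact_iff_compactSpace.mpr inferInstance
  have hA : IsClosed ((Subgroup.map (φ : ↥(unitaryGroupOfForm (starRingEnd ℂ) ((Matrix.diagonal ![α (lineOf (formSign L α w₀) 0), α (lineOf (formSign L α w₀) 2)]).map w₀.1.embedding)) →* ↥(unitaryGroupOfForm (starRingEnd ℂ) J)) ((circleDiagonal 2).codRestrict (unitaryGroupOfForm (starRingEnd ℂ) ((Matrix.diagonal ![α (lineOf (formSign L α w₀) 0), α (lineOf (formSign L α w₀) 2)]).map w₀.1.embedding)) (circleDiagonal_mem_archLocal_diagonal L 2 ![α (lineOf (formSign L α w₀) 0), α (lineOf (formSign L α w₀) 2)] w₀)).range) :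
      Set ↥(unitaryGroupOfForm (starRingEnd ℂ) J)) := hAcpt.isClosed
  letI : CommGroup ↥K := { (inferInstance : Group ↥K) with mul_comm := fun a b => Subtype.ext (hKcomm _ a.2 _ b.2) }
  let νK : Measure ↥K := haarMeasure (Classical.arbitrary (TopologicalSpace.PositiveCompacts ↥K))
  haveI : νK.IsInvInvariant := IsHaarMeasure.isInvInvariant_of_regular νK
  haveI : νK.IsMulRightInvariant := isMulRightInvariant_of_isInvInvariant νK
  letI : CommGroup ↥(Subgroup.map (φ : ↥(unitaryGroupOfForm (starRingEnd ℂ) ((Matrix.diagonal ![α (lineOf (formSign L α w₀) 0), α (lineOf (formSign L α w₀) 2)]).map w₀.1.embedding)) →* ↥(unitaryGroupOfForm (starRingEnd ℂ) J)) ((circleDiagonal 2).codRestrict (unitaryGroupOfForm (starRingEnd ℂ) ((Matrix.diagonal ![α (lineOf (formSign L α w₀) 0), α (lineOf (formSign L α w₀) 2)]).map w₀.1.embedding)) (circleDiagonal_mem_archLocal_diagonal L 2 ![α (lineOf (formSign L α w₀) 0), α (lineOf (formSign L α w₀) 2)] w₀)).range) :=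
    { (inferInstance : Group _) with mul_comm := hAcomm }
  let ρA : Measure ↥(Subgroup.map (φ : ↥(unitaryGroupOfForm (starRingEnd ℂ) ((Matrix.diagonal ![α (lineOf (formSign L α w₀) 0), α (lineOf (formSign L α w₀) 2)]).map w₀.1.embedding)) →* ↥(unitaryGroupOfForm (starRingEnd ℂ) J)) ((circleDiagonal 2).codRestrict (unitaryGroupOfForm (starRingEnd ℂ) ((Matrix.diagonal ![α (lineOf (formSign L α w₀) 0), α (lineOf (formSign L α w₀) 2)]).map w₀.1.embedding)) (circleDiagonal_mem_archLocal_diagonal L 2 ![α (lineOf (formSign L α w₀) 0), α (lineOf (formSign L α w₀) 2)] w₀)).range) :=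
    haarMeasure (Classical.arbitrary (TopologicalSpace.PositiveCompacts _))
  haveI : ρA.IsInvInvariant := IsHaarMeasure.isInvInvariant_of_regular ρA
  obtain ⟨κ, hκ, hmap, -⟩ := exists_smul_map_mk_of_block_compact e' ((chartTorusGLoc L α w₀ S).subgroupOf _) hTc _ hA hmem Ψ hΨ
    (Measure.map (Subgroup.subgroupOfEquivOfLe hT).symm t₀) νM ρA μ₀ νK
  -- ### Harish-Chandra's compactness at `w₀` on a ball around `x₀` (§2) and ONE cut-off `β` (★ p850338)
  obtain ⟨CS, V, hCSc, hVo, hx₀V, hVsimple, hCM⟩ := exists_isCompact_mul_centralizer_ball_gprimeBlockAt L α S w₀ hα hreal₀ hw₀ hx02 hx1 hC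
  obtain ⟨β, hβc, hβs, hβ0, -, hβ1⟩ := exists_continuous_hasCompactSupport_integral_comp_mul_eq_one_pos
    (Subgroup.centralizer ({gprimeBlockAt L α w₀ S x₀} : Set ↥(archLocal L 3 (Matrix.diagonal α) w₀))) hZc νM hCSc
  -- ### the descended FAMILY `(B y)_M^β` (continuous) and its SMOOTH ambient reading `Θ` (§3), the block embedding `Λ`, φ's frame matrix `M₀`
  have haMc : ∀ y, Continuous fun m : ↥(Subgroup.centralizer ({gprimeBlockAt L α w₀ S x₀} : Set ↥(archLocal L 3 (Matrix.diagonal α) w₀))) =>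
      ∫ x, β x • B y (x * (m : ↥(archLocal L 3 (Matrix.diagonal α) w₀)) * x⁻¹) ∂ν₀ := fun y =>
    continuous_integral_conj_subtype ν₀ _ hβc hβs (hBc y)
  obtain ⟨Θ, hΘdef⟩ : ∃ Θ : P × Matrix (Fin 3) (Fin 3) ℂ → ℂ, Θ = fun q =>
      ∫ x, β x • Ξ (q.1, ((x : GL (Fin 3) ℂ) : Matrix (Fin 3) (Fin 3) ℂ) * q.2 * (((x⁻¹ : ↥(archLocal L 3 (Matrix.diagonal α) w₀)) : GL (Fin 3) ℂ) : Matrix (Fin 3) (Fin 3) ℂ)) ∂ν₀ := ⟨_, rfl⟩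
  have hΘ : ContDiff ℝ ∞ Θ := by rw [hΘdef]; exact contDiff_integral_smul_comp_conj_param ν₀ Ξ hΞ β hβc hβs
  have haM : ∀ y (m : ↥(Subgroup.centralizer ({gprimeBlockAt L α w₀ S x₀} : Set ↥(archLocal L 3 (Matrix.diagonal α) w₀)))),
      ∫ x, β x • B y (x * (m : ↥(archLocal L 3 (Matrix.diagonal α) w₀)) * x⁻¹) ∂ν₀ =
        Θ (y, (((m : ↥(archLocal L 3 (Matrix.diagonal α) w₀)) : GL (Fin 3) ℂ) : Matrix (Fin 3) (Fin 3) ℂ)) := fun y m => by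
    rw [hΘdef]
    refine integral_congr_ae (Filter.Eventually.of_forall fun x => ?_)
    simp only [hBΞ, Subgroup.coe_mul, Units.val_mul]
  obtain ⟨Λ, hΛ, hΛb⟩ : ∃ Λ : Matrix (Fin 2) (Fin 2) ℂ → Matrix (Fin 3) (Fin 3) ℂ, ContDiff ℝ ∞ Λ ∧
      ∀ b : ↥(unitaryGroupOfForm (starRingEnd ℂ) ((Matrix.diagonal ![α (lineOf (formSign L α w₀) 0), α (lineOf (formSign L α w₀) 2)]).map w₀.1.embedding)),
        ((((e.symm (b, 1) : ↥(Subgroup.centralizer ({gprimeBlockAt L α w₀ S x₀} : Set ↥(archLocal L 3 (Matrix.diagonal α) w₀)))) :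
            ↥(archLocal L 3 (Matrix.diagonal α) w₀)) : GL (Fin 3) ℂ) : Matrix (Fin 3) (Fin 3) ℂ) = Λ ((b : GL (Fin 2) ℂ) : Matrix (Fin 2) (Fin 2) ℂ) := by
    obtain ⟨Tm, hTm⟩ : ∃ Tm : GL (Fin 3) ℂ, Tm = Matrix.GeneralLinearGroup.mkOfDetNeZero _ (det_monomial_one_ne_zero 3 (lineOf (formSign L α w₀))) := ⟨_, rfl⟩
    refine ⟨fun X => (Tm : Matrix (Fin 3) (Fin 3) ℂ) * (!![X 0 0, 0, X 0 1; 0, 1, 0; X 1 0, 0, X 1 1] : Matrix (Fin 3) (Fin 3) ℂ) * ((Tm⁻¹ : GL (Fin 3) ℂ) : Matrix (Fin 3) (Fin 3) ℂ),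
      (contDiff_const.mul contDiff_blockPattern).mul contDiff_const, fun b => ?_⟩
    have h1 : ((((1 : ↥(unitaryGroupOfForm (starRingEnd ℂ) ((Matrix.diagonal ![(α ∘ (lineOf (formSign L α w₀))) 1]).map w₀.1.embedding))) : GL (Fin 1) ℂ) : Matrix (Fin 1) (Fin 1) ℂ) 0 0) = 1 := by
      rw [OneMemClass.coe_one, Units.val_one, Matrix.one_apply_eq]
    rw [h8 b, ContinuousMulEquiv.coe_restrictSubgroup_apply, GLn.conjEquiv_apply, Units.val_mul, Units.val_mul, coe_endoEmb, coe_endoGL_eq, h1, hTm]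
  obtain ⟨M₀, hM₀⟩ : ∃ M₀ : GL (Fin 2) ℂ, ∀ h : ↥(unitaryGroupOfForm (starRingEnd ℂ) ((Matrix.diagonal ![α (lineOf (formSign L α w₀) 0), α (lineOf (formSign L α w₀) 2)]).map w₀.1.embedding)),
      ((φ h : ↥(unitaryGroupOfForm (starRingEnd ℂ) J)) : GL (Fin 2) ℂ) = M₀ * (h : GL (Fin 2) ℂ) * M₀⁻¹ :=
    ⟨_, fun h => by rw [hval h, _root_.mul_inv_rev]⟩
  have hφsymm : ∀ u : ↥(unitaryGroupOfForm (starRingEnd ℂ) J),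
      (((φ.symm u : ↥(unitaryGroupOfForm (starRingEnd ℂ) ((Matrix.diagonal ![α (lineOf (formSign L α w₀) 0), α (lineOf (formSign L α w₀) 2)]).map w₀.1.embedding))) : GL (Fin 2) ℂ) : Matrix (Fin 2) (Fin 2) ℂ) =
        ((M₀⁻¹ : GL (Fin 2) ℂ) : Matrix (Fin 2) (Fin 2) ℂ) * ((u : GL (Fin 2) ℂ) : Matrix (Fin 2) (Fin 2) ℂ) * ((M₀ : GL (Fin 2) ℂ) : Matrix (Fin 2) (Fin 2) ℂ) := fun u => by
    have h := hM₀ (φ.symm u)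
    rw [ContinuousMulEquiv.apply_symm_apply] at h
    have h' : ((φ.symm u : ↥(unitaryGroupOfForm (starRingEnd ℂ) ((Matrix.diagonal ![α (lineOf (formSign L α w₀) 0), α (lineOf (formSign L α w₀) 2)]).map w₀.1.embedding))) : GL (Fin 2) ℂ) =
        M₀⁻¹ * (u : GL (Fin 2) ℂ) * M₀ := by
      rw [h]; group
    rw [h', Units.val_mul, Units.val_mul]
  -- `e′⁻¹(u, r) = e⁻¹(φ⁻¹ u, 1) · r` for every `r ∈ K₀` (clause [10])
  have hsymm : ∀ (u : ↥(unitaryGroupOfForm (starRingEnd ℂ) J)) (r : ↥K),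
      e'.symm (u, r) = e.symm (φ.symm u, 1) * (r : ↥(Subgroup.centralizer ({gprimeBlockAt L α w₀ S x₀} : Set ↥(archLocal L 3 (Matrix.diagonal α) w₀)))) := fun u r => by
    apply e'.injective
    rw [ContinuousMulEquiv.apply_symm_apply, map_mul, he', he', ContinuousMulEquiv.apply_symm_apply, ContinuousMulEquiv.apply_symm_apply, h10 _ r.2]
    ext <;> simp
  -- ONE compact set `D ⊆ G₀` outside of which every descended family member vanishes, and ONE ambient cut-off `χ ≡ 1` on its block shadow
  have hDc : IsCompact ((fun p : ↥(archLocal L 3 (Matrix.diagonal α) w₀) × ↥(archLocal L 3 (Matrix.diagonal α) w₀) => p.1⁻¹ * p.2 * p.1) '' (tsupport β ×ˢ C)) :=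
    (hβs.isCompact.prod hC).image ((continuous_fst.inv.mul continuous_snd).mul continuous_fst)
  have haM0 : ∀ y ∈ O, ∀ m : ↥(Subgroup.centralizer ({gprimeBlockAt L α w₀ S x₀} : Set ↥(archLocal L 3 (Matrix.diagonal α) w₀))),
      (m : ↥(archLocal L 3 (Matrix.diagonal α) w₀)) ∉ (fun p : ↥(archLocal L 3 (Matrix.diagonal α) w₀) × ↥(archLocal L 3 (Matrix.diagonal α) w₀) => p.1⁻¹ * p.2 * p.1) '' (tsupport β ×ˢ C) →
        ∫ x, β x • B y (x * (m : ↥(archLocal L 3 (Matrix.diagonal α) w₀)) * x⁻¹) ∂ν₀ = 0 := by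
    intro y hy m hm
    refine integral_eq_zero_of_ae (Filter.Eventually.of_forall fun x => ?_)
    by_cases hx : x ∈ tsupport β
    · have hxm : x * (m : ↥(archLocal L 3 (Matrix.diagonal α) w₀)) * x⁻¹ ∉ C := by
        intro hmem'
        exact hm ⟨(x, x * (m : ↥(archLocal L 3 (Matrix.diagonal α) w₀)) * x⁻¹), ⟨hx, hmem'⟩, by dsimp only; group⟩
      show β x • B y (x * (m : ↥(archLocal L 3 (Matrix.diagonal α) w₀)) * x⁻¹) = 0
      rw [hBC y (hOO₁ hy) _ hxm, smul_zero]
    · show β x • B y (x * (m : ↥(archLocal L 3 (Matrix.diagonal α) w₀)) * x⁻¹) = 0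
      rw [image_eq_zero_of_notMem_tsupport hx, zero_smul]
  have hDM : IsCompact (((↑) : ↥(Subgroup.centralizer ({gprimeBlockAt L α w₀ S x₀} : Set ↥(archLocal L 3 (Matrix.diagonal α) w₀))) → ↥(archLocal L 3 (Matrix.diagonal α) w₀)) ⁻¹'
      ((fun p : ↥(archLocal L 3 (Matrix.diagonal α) w₀) × ↥(archLocal L 3 (Matrix.diagonal α) w₀) => p.1⁻¹ * p.2 * p.1) '' (tsupport β ×ˢ C))) :=
    hZc.isClosedEmbedding_subtypeVal.isCompact_preimage hDc
  have hS₀ : IsCompact ((fun u : ↥(unitaryGroupOfForm (starRingEnd ℂ) J) => ((u : GL (Fin 2) ℂ) : Matrix (Fin 2) (Fin 2) ℂ)) '' (Prod.fst '' (e' ''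
      (((↑) : ↥(Subgroup.centralizer ({gprimeBlockAt L α w₀ S x₀} : Set ↥(archLocal L 3 (Matrix.diagonal α) w₀))) → ↥(archLocal L 3 (Matrix.diagonal α) w₀)) ⁻¹'
        ((fun p : ↥(archLocal L 3 (Matrix.diagonal α) w₀) × ↥(archLocal L 3 (Matrix.diagonal α) w₀) => p.1⁻¹ * p.2 * p.1) '' (tsupport β ×ˢ C)))))) :=
    (((hDM.image e'.continuous).image continuous_fst).image (Units.continuous_val.comp continuous_subtype_val))
  obtain ⟨χ, hχd, hχc, hχ1, -⟩ := Literature.Analysis.Calculus.exists_contDiff_hasCompactSupport_eq_one_of_isCompact hS₀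
  -- the tangential spectator `cw ↦ ↑↑γ₀(0, cw1, 0)` is smooth
  have hupd : ContDiff ℝ ∞ fun cw : Fin 3 → ℝ => (fun _ : {w : InfinitePlace L // IsComplex w} => (![0, cw 1, 0] : Fin 3 → ℝ)) := by
    refine contDiff_pi.2 fun _ => contDiff_pi.2 fun i => ?_
    fin_cases i
    · exact contDiff_const
    · exact contDiff_apply ℝ ℝ 1
    · exact contDiff_const
  have hRρ : ContDiff ℝ ∞ fun cw : Fin 3 → ℝ =>
      (((gprimeBlockAt L α w₀ S ![0, cw 1, 0] : ↥(archLocal L 3 (Matrix.diagonal α) w₀)) : GL (Fin 3) ℂ) : Matrix (Fin 3) (Fin 3) ℂ) :=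
    (contDiff_coe_gprimeBlock L α S w₀).comp hupd
  -- the family `f`
  obtain ⟨f, hf⟩ : ∃ f : (P × (Fin 3 → ℝ)) × Matrix (Fin 2) (Fin 2) ℂ → ℂ, f = fun q =>
      (χ q.2 : ℂ) * Θ (q.1.1, Λ (((M₀⁻¹ : GL (Fin 2) ℂ) : Matrix (Fin 2) (Fin 2) ℂ) * q.2 * ((M₀ : GL (Fin 2) ℂ) : Matrix (Fin 2) (Fin 2) ℂ)) *
        (((gprimeBlockAt L α w₀ S ![0, q.1.2 1, 0] : ↥(archLocal L 3 (Matrix.diagonal α) w₀)) : GL (Fin 3) ℂ) : Matrix (Fin 3) (Fin 3) ℂ)) := ⟨_, rfl⟩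
  have hfs : ContDiff ℝ ∞ f := by
    rw [hf]
    refine ((Complex.ofRealCLM.contDiff.comp ((hχd ⊤).comp contDiff_snd)).mul
      (hΘ.comp ((contDiff_fst.comp contDiff_fst).prodMk
        (((hΛ.comp ((contDiff_const.mul contDiff_snd).mul contDiff_const)).mul (hRρ.comp (contDiff_snd.comp contDiff_fst)))))))
  -- `f ((y, cw), ↑↑u) = (B y)_M^β (e′⁻¹(u, (e γ₀(cw)).2))` for `y ∈ O` and every `cw`, `u`
  have hfB : ∀ y ∈ O, ∀ (cw : Fin 3 → ℝ) (u : ↥(unitaryGroupOfForm (starRingEnd ℂ) J)),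
      (fun m : ↥(Subgroup.centralizer ({gprimeBlockAt L α w₀ S x₀} : Set ↥(archLocal L 3 (Matrix.diagonal α) w₀))) =>
        ∫ x, β x • B y (x * (m : ↥(archLocal L 3 (Matrix.diagonal α) w₀)) * x⁻¹) ∂ν₀)
        (e'.symm (u, (e ⟨gprimeBlockAt L α w₀ S cw, gprimeBlockAt_mem_centralizer L α S w₀ x₀ cw⟩).2)) = f ((y, cw), ((u : GL (Fin 2) ℂ) : Matrix (Fin 2) (Fin 2) ℂ)) := by
    intro y hy cw u
    beta_reduce
    -- the smooth reading of the value
    have hread : Θ (y, ((((e'.symm (u, (e ⟨gprimeBlockAt L α w₀ S cw, gprimeBlockAt_mem_centralizer L α S w₀ x₀ cw⟩).2) :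
        ↥(Subgroup.centralizer ({gprimeBlockAt L α w₀ S x₀} : Set ↥(archLocal L 3 (Matrix.diagonal α) w₀)))) :
          ↥(archLocal L 3 (Matrix.diagonal α) w₀)) : GL (Fin 3) ℂ) : Matrix (Fin 3) (Fin 3) ℂ)) =
        Θ (y, Λ (((M₀⁻¹ : GL (Fin 2) ℂ) : Matrix (Fin 2) (Fin 2) ℂ) * ((u : GL (Fin 2) ℂ) : Matrix (Fin 2) (Fin 2) ℂ) * ((M₀ : GL (Fin 2) ℂ) : Matrix (Fin 2) (Fin 2) ℂ)) *
          (((gprimeBlockAt L α w₀ S ![0, cw 1, 0] : ↥(archLocal L 3 (Matrix.diagonal α) w₀)) : GL (Fin 3) ℂ) : Matrix (Fin 3) (Fin 3) ℂ)) := by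
      rw [hsymm, Subgroup.coe_mul, Subgroup.coe_mul, Units.val_mul, hΛb (φ.symm u), hφsymm u, h6 cw]
    by_cases hu : (e'.symm (u, (e ⟨gprimeBlockAt L α w₀ S cw, gprimeBlockAt_mem_centralizer L α S w₀ x₀ cw⟩).2)) ∈
        (((↑) : ↥(Subgroup.centralizer ({gprimeBlockAt L α w₀ S x₀} : Set ↥(archLocal L 3 (Matrix.diagonal α) w₀))) → ↥(archLocal L 3 (Matrix.diagonal α) w₀)) ⁻¹'
          ((fun p : ↥(archLocal L 3 (Matrix.diagonal α) w₀) × ↥(archLocal L 3 (Matrix.diagonal α) w₀) => p.1⁻¹ * p.2 * p.1) '' (tsupport β ×ˢ C)))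
    · have hχu : χ ((u : GL (Fin 2) ℂ) : Matrix (Fin 2) (Fin 2) ℂ) = 1 :=
        hχ1 _ ⟨u, ⟨(u, (e ⟨gprimeBlockAt L α w₀ S cw, gprimeBlockAt_mem_centralizer L α S w₀ x₀ cw⟩).2), ⟨_, hu, e'.apply_symm_apply _⟩, rfl⟩, rfl⟩
      rw [hf]
      beta_reduce
      rw [hχu, Complex.ofReal_one, one_mul, haM, hread]
    · have h0 := haM0 y hy _ hu
      beta_reduce at h0
      have h0' := h0
      rw [haM, hread] at h0'
      rw [h0, hf]
      beta_reduce
      rw [h0', mul_zero]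
  -- ### the descent constant `K = κ ≠ 0`
  have hK0 : (((κ : ℝ) : ℂ)) ≠ 0 := Complex.ofReal_ne_zero.2 (NNReal.coe_ne_zero.2 hκ)
  -- ### the quotient measure on `G₀ ⧸ T₀` is finite on compacts
  haveI : IsFiniteMeasureOnCompacts (quotientMeasure (chartTorusGLoc L α w₀ S) t₀ (isClosed_chartTorusGLoc L α w₀ S) ν₀) := inferInstance
  -- ### the block reading of `γ₀(cw)` through `e′` ([5] + (B-STD) (i))
  have hγ : ∀ cw : Fin 3 → ℝ,
      e' ⟨gprimeBlockAt L α w₀ S cw, hT (gprimeBlockAt_mem_chartTorusGLoc L α w₀ S cw)⟩ =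
        ((⟨Matrix.GeneralLinearGroup.mkOfDetNeZero !![(1 : ℂ), 1; 1, -1] det_cayleyTwo_ne_zero *
            circleDiagonal 2 ![Circle.exp (cw 0), Circle.exp (cw 2)] *
            (Matrix.GeneralLinearGroup.mkOfDetNeZero !![(1 : ℂ), 1; 1, -1] det_cayleyTwo_ne_zero)⁻¹, cayley_conj_circleDiagonal_mem_of_eq_over hJ _⟩ : ↥(unitaryGroupOfForm (starRingEnd ℂ) J)),
          (e ⟨gprimeBlockAt L α w₀ S cw, gprimeBlockAt_mem_centralizer L α S w₀ x₀ cw⟩).2) := by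
    intro cw
    have h1 : (e ⟨gprimeBlockAt L α w₀ S cw, gprimeBlockAt_mem_centralizer L α S w₀ x₀ cw⟩).1 =
        ⟨circleDiagonal 2 ![Circle.exp (cw 0), Circle.exp (cw 2)],
          circleDiagonal_mem_unitaryGroupOfForm_diagonal_map_weights w₀.1.embedding ![α (lineOf (formSign L α w₀) 0), α (lineOf (formSign L α w₀) 2)] _⟩ :=
      Subtype.ext (h5 cw)
    rw [he', h1, hφ]
  -- ### assembling
  refine ⟨((κ : ℝ) : ℂ), O, V, f, hK0, hOo, hy₀O, hVo, hx₀V, hfs, ⟨tsupport χ, hχc, fun y cw X hX => ?_⟩, fun y cw X => ?_, ?_⟩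
  · rw [hf]; dsimp only; rw [image_eq_zero_of_notMem_tsupport hX, Complex.ofReal_zero, zero_mul]
  · rw [hf]; dsimp only
    simp
  intro y hy cw hcw hreg
  -- regularity of `cw` and integrability of the orbital integrand on `G₀ ⧸ T₀` (`T₀` is compact at a compact-chart place)
  have hinj : Function.Injective fun i : Fin 3 => Circle.exp (cw i) :=
    injective_fin_three_of_ne (f := fun i : Fin 3 => Circle.exp (cw i)) (hVsimple cw hcw).1.symm hreg (hVsimple cw hcw).2
  have hw : ¬ (w₀ ∈ S ∧ w₀ ∈ splitChartPlaces L α) := fun h => hw₀ h.1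
  obtain ⟨𝒦, h𝒦, hmem𝒦⟩ := uniformlyProper_gprimeBlock_cpt_of_injective L α S hα hw (chartTorusGLoc L α w₀ S) {cw}
    (Set.singleton_subset_iff.2 hinj) isCompact_singleton C hC
  have hint : Integrable (descConj (gprimeBlockAt L α w₀ S cw) (chartTorusGLoc L α w₀ S) (forall_mem_chartTorusGLoc_comm L α w₀ S cw) (B y))
      (quotientMeasure (chartTorusGLoc L α w₀ S) t₀ (isClosed_chartTorusGLoc L α w₀ S) ν₀) :=
    integrable_descConj_of_exists_isCompact (chartTorusGLoc L α w₀ S) (isClosed_chartTorusGLoc L α w₀ S) _ (forall_mem_chartTorusGLoc_comm L α w₀ S cw) (hBc y)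
      h𝒦 (fun q hq => hmem𝒦 cw (Set.mem_singleton cw) q (hBts y hy hq)) _
  -- ★ D3: descent to `Z(γ₀(x₀))` with the cut-off `β`
  have key := integral_descConj_eq_integral_descConj_descended ν₀ (Subgroup.centralizer ({gprimeBlockAt L α w₀ S x₀} : Set ↥(archLocal L 3 (Matrix.diagonal α) w₀))) hZc νM
    ⟨gprimeBlockAt L α w₀ S cw, hT (gprimeBlockAt_mem_chartTorusGLoc L α w₀ S cw)⟩
    (chartTorusGLoc L α w₀ S) (isClosed_chartTorusGLoc L α w₀ S) (forall_mem_chartTorusGLoc_comm L α w₀ S cw)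
    ((chartTorusGLoc L α w₀ S).subgroupOf (Subgroup.centralizer ({gprimeBlockAt L α w₀ S x₀} : Set ↥(archLocal L 3 (Matrix.diagonal α) w₀)))) hTc
    (fun t ht => Subtype.ext (forall_mem_chartTorusGLoc_comm L α w₀ S cw (t : ↥(archLocal L 3 (Matrix.diagonal α) w₀)) (Subgroup.mem_subgroupOf.1 ht)))
    (fun t ht => Subgroup.mem_subgroupOf.1 ht)
    t₀ (Measure.map (Subgroup.subgroupOfEquivOfLe hT).symm t₀)
    (eq_map_incl_map_subgroupOfEquivOfLe_symm hT t₀)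
    hβc hβs hβ0 hβ1 (hBc y) hint (fun q hq => hCM cw hcw q (hBts y hy hq))
  refine key.trans ?_
  rw [integral_descConj_eq_smul_integral_of_block _ _ e' Ψ hΨ _ μ₀ hmap _ _ _ (hγ cw) _ (haMc y), NNReal.smul_def, Complex.real_smul]
  congr 1
  refine integral_congr_ae (Filter.Eventually.of_forall fun b => ?_)
  exact hfB y hy cw _


set_option maxHeartbeats 1600000 in
/-- **(H-core)∕(X-core) L1 ON A WHOLE PARAMETER SET — ED. 2 (LH5-p02 (g4), 2026-09-02; binder of record for the edition: LH5-p02).**  The same statement as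
`exists_descent_box_local_param` with ONE change of bookkeeping: the compact `g`-support of the family `B(y)` is assumed uniform over a given set `O ⊆ P`
(any `O ⊆ P`, openness not even needed: `hBsupp : ∃ C compact, ∀ y ∈ O, ∀ g ∉ C, B y g = 0`) and the descent identity is concluded for EVERY `y ∈ O` (no base parameter `y₀`, no shrinking):
the proof of ED. 1 uses its neighbourhood `O ∋ y₀` only through that support clause, so the text below is that proof verbatim with the `mem_nhds_iff` shrinking step removed.
Needed by the many-places induction (X-core) L1^ι `exists_descent_box_local_param_pi` (`ArchLocalWallDescentParamPi`), whose outer conjugates range over a COMPACT parameter set,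
not over a neighbourhood of one point. [cite: Rogawski1990, §4.12 Lemma 4.12.1 p. 61; §8.2 pp. 119–124] [cite: HarishChandra1970, Part V §4] [cite: Shelstad1979, §4 Lemma 4.3 (p. 25)]
[cite: HormanderALPDO1, Thm. 1.1.9] -/
theorem exists_descent_box_local_param_on (hα : ∀ i, α i ≠ 0) (hreal₀ : ∀ i : Fin 3, (w₀.1.embedding (α i)).im = 0)
    {J : Matrix (Fin 2) (Fin 2) ℂ} (hJ : J = (StdForm.antidiagonal 2).over ℂ)
    [MeasurableSpace ↥(unitaryGroupOfForm (starRingEnd ℂ) J)] [BorelSpace ↥(unitaryGroupOfForm (starRingEnd ℂ) J)]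
    [LocallyCompactSpace ↥(unitaryGroupOfForm (starRingEnd ℂ) J)] [SecondCountableTopology ↥(unitaryGroupOfForm (starRingEnd ℂ) J)]
    (μ₀ : Measure ↥(unitaryGroupOfForm (starRingEnd ℂ) J)) [μ₀.IsHaarMeasure] [μ₀.IsMulRightInvariant]
    (hw₀ : w₀ ∉ S) (hwsp : w₀ ∈ splitChartPlaces L α)
    {x₀ : Fin 3 → ℝ} (hx02 : x₀ 0 = x₀ 2) (hx1 : Circle.exp (x₀ 1) ≠ Circle.exp (x₀ 0))
    {P : Type*} [NormedAddCommGroup P] [NormedSpace ℝ P] [FiniteDimensional ℝ P] {O : Set P}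
    (B : P → ↥(archLocal L 3 (Matrix.diagonal α) w₀) → ℂ) (Ξ : P × Matrix (Fin 3) (Fin 3) ℂ → ℂ) (hΞ : ContDiff ℝ ∞ Ξ)
    (hBΞ : ∀ y g, B y g = Ξ (y, ((g : GL (Fin 3) ℂ) : Matrix (Fin 3) (Fin 3) ℂ)))
    (hBsupp : ∃ C : Set ↥(archLocal L 3 (Matrix.diagonal α) w₀), IsCompact C ∧ ∀ y ∈ O, ∀ g ∉ C, B y g = 0) :
    ∃ (K : ℂ) (V : Set (Fin 3 → ℝ)) (f : (P × (Fin 3 → ℝ)) × Matrix (Fin 2) (Fin 2) ℂ → ℂ),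
      K ≠ 0 ∧ IsOpen V ∧ x₀ ∈ V ∧ ContDiff ℝ ∞ f ∧
      (∃ C : Set (Matrix (Fin 2) (Fin 2) ℂ), IsCompact C ∧ ∀ y cw X, X ∉ C → f ((y, cw), X) = 0) ∧
      (∀ y cw X, f ((y, cw), X) = f ((y, ![0, cw 1, 0]), X)) ∧
      ∀ y ∈ O, ∀ cw ∈ V, Circle.exp (cw 0) ≠ Circle.exp (cw 2) →
        ∫ q, descConj (gprimeBlockAt L α w₀ S cw) (chartTorusGLoc L α w₀ S) (forall_mem_chartTorusGLoc_comm L α w₀ S cw) (B y) q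
            ∂(quotientMeasure (chartTorusGLoc L α w₀ S) t₀ (isClosed_chartTorusGLoc L α w₀ S) ν₀) =
          K * ∫ h : ↥(unitaryGroupOfForm (starRingEnd ℂ) J),
            f ((y, cw), (((h * ⟨Matrix.GeneralLinearGroup.mkOfDetNeZero !![(1 : ℂ), 1; 1, -1] det_cayleyTwo_ne_zero *
                circleDiagonal 2 ![Circle.exp (cw 0), Circle.exp (cw 2)] *
                (Matrix.GeneralLinearGroup.mkOfDetNeZero !![(1 : ℂ), 1; 1, -1] det_cayleyTwo_ne_zero)⁻¹,
              cayley_conj_circleDiagonal_mem_of_eq_over hJ _⟩ * h⁻¹ : ↥(unitaryGroupOfForm (starRingEnd ℂ) J)) : GL (Fin 2) ℂ) : Matrix (Fin 2) (Fin 2) ℂ)) ∂μ₀ := by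
  -- ### notation-free abbreviations used only in `have` types
  -- ### frame facts
  obtain ⟨hreal2, hsgn⟩ := blockWeights_of_mem_splitChartPlaces L α w₀ hwsp
  have h02c : Circle.exp (x₀ 0) = Circle.exp (x₀ 2) := by rw [hx02]
  have h01 : Circle.exp (x₀ 0) ≠ Circle.exp (x₀ 1) := fun h => hx1 h.symm
  -- ### the family: continuity and ONE compact support near `y₀`
  obtain ⟨C, hC, hBC⟩ := hBsupp
  have hBc : ∀ y, Continuous (B y) := fun y => by
    have h : B y = fun g : ↥(archLocal L 3 (Matrix.diagonal α) w₀) => Ξ (y, ((g : GL (Fin 3) ℂ) : Matrix (Fin 3) (Fin 3) ℂ)) := funext fun g => hBΞ y g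
    rw [h]
    exact hΞ.continuous.comp (continuous_const.prodMk (Units.continuous_val.comp continuous_subtype_val))
  have hBts : ∀ y ∈ O, tsupport (B y) ⊆ C := fun y hy =>
    closure_minimal (fun g hg => by_contra fun hgC => hg (hBC y hy g hgC)) hC.isClosed
  have hBs : ∀ y ∈ O, HasCompactSupport (B y) := fun y hy => HasCompactSupport.of_support_subset_isCompact hC
    (fun g hg => by_contra fun hgC => hg (hBC y hy g hgC))
  -- ### LOCAL (M-UNFOLD) (§1): `e : Z(γ₀(x₀)) ≃ₜ* B × K₀` with clauses [4]–[10]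
  refine (exists_continuousMulEquiv_centralizer_gprimeBlockAt_wall_explicit L α S w₀ hα hw₀ x₀ h02c h01).elim fun K hK => hK.elim fun e he => ?_
  obtain ⟨hKc, hKsub, hKcomm, h4, h5, h6, hmapT, h8, h10⟩ := he
  -- ### (B-STD) package: `φ`, `e′`, `Ψ` (★ `exists_std_package`, generic in the group)
  refine (exists_std_package L α w₀ hJ hreal2 hsgn e _ _ hmapT).elim fun φ hφ => hφ.elim fun e' hY => hY.elim fun Ψ hZ => ?_
  have hφ := hZ.1
  have hval := hZ.2.1
  have he' := hZ.2.2.1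
  have hmem := hZ.2.2.2.2.1
  have hΨ := hZ.2.2.2.2.2.2
  -- ### the local chart torus sits inside `Z(γ₀(x₀))`
  have hT : chartTorusGLoc L α w₀ S ≤ Subgroup.centralizer ({gprimeBlockAt L α w₀ S x₀} : Set ↥(archLocal L 3 (Matrix.diagonal α) w₀)) :=
    chartTorusGLoc_le_centralizer L α w₀ S x₀
  -- ### instances on `Z(γ₀(x₀))`, its quotient, `K₀`, `U(J) ⧸ φ(A)`
  have hZc : IsClosed ((Subgroup.centralizer ({gprimeBlockAt L α w₀ S x₀} : Set ↥(archLocal L 3 (Matrix.diagonal α) w₀))) :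
      Set ↥(archLocal L 3 (Matrix.diagonal α) w₀)) := isClosed_centralizer_singleton_of_t2 _
  haveI : LocallyCompactSpace ↥(Subgroup.centralizer ({gprimeBlockAt L α w₀ S x₀} : Set ↥(archLocal L 3 (Matrix.diagonal α) w₀))) := hZc.isClosedEmbedding_subtypeVal.locallyCompactSpace
  haveI : SecondCountableTopology ↥(Subgroup.centralizer ({gprimeBlockAt L α w₀ S x₀} : Set ↥(archLocal L 3 (Matrix.diagonal α) w₀))) := TopologicalSpace.Subtype.secondCountableTopology _
  letI : MeasurableSpace (↥(Subgroup.centralizer ({gprimeBlockAt L α w₀ S x₀} : Set ↥(archLocal L 3 (Matrix.diagonal α) w₀))) ⧸ (chartTorusGLoc L α w₀ S).subgroupOf (Subgroup.centralizer ({gprimeBlockAt L α w₀ S x₀} : Set ↥(archLocal L 3 (Matrix.diagonal α) w₀)))) := borel _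
  haveI : BorelSpace (↥(Subgroup.centralizer ({gprimeBlockAt L α w₀ S x₀} : Set ↥(archLocal L 3 (Matrix.diagonal α) w₀))) ⧸ (chartTorusGLoc L α w₀ S).subgroupOf (Subgroup.centralizer ({gprimeBlockAt L α w₀ S x₀} : Set ↥(archLocal L 3 (Matrix.diagonal α) w₀)))) := ⟨rfl⟩
  haveI : LocallyCompactSpace ↥K := hKc.isClosedEmbedding_subtypeVal.locallyCompactSpace
  haveI : SecondCountableTopology ↥K := TopologicalSpace.Subtype.secondCountableTopology _
  letI : MeasurableSpace ↥K := borel _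
  haveI : BorelSpace ↥K := ⟨rfl⟩
  letI : MeasurableSpace (↥(unitaryGroupOfForm (starRingEnd ℂ) J) ⧸ Subgroup.map (φ : ↥(unitaryGroupOfForm (starRingEnd ℂ) ((Matrix.diagonal ![α (lineOf (formSign L α w₀) 0), α (lineOf (formSign L α w₀) 2)]).map w₀.1.embedding)) →* ↥(unitaryGroupOfForm (starRingEnd ℂ) J)) ((circleDiagonal 2).codRestrict (unitaryGroupOfForm (starRingEnd ℂ) ((Matrix.diagonal ![α (lineOf (formSign L α w₀) 0), α (lineOf (formSign L α w₀) 2)]).map w₀.1.embedding)) (circleDiagonal_mem_archLocal_diagonal L 2 ![α (lineOf (formSign L α w₀) 0), α (lineOf (formSign L α w₀) 2)] w₀)).range) := borel _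
  haveI : BorelSpace (↥(unitaryGroupOfForm (starRingEnd ℂ) J) ⧸ Subgroup.map (φ : ↥(unitaryGroupOfForm (starRingEnd ℂ) ((Matrix.diagonal ![α (lineOf (formSign L α w₀) 0), α (lineOf (formSign L α w₀) 2)]).map w₀.1.embedding)) →* ↥(unitaryGroupOfForm (starRingEnd ℂ) J)) ((circleDiagonal 2).codRestrict (unitaryGroupOfForm (starRingEnd ℂ) ((Matrix.diagonal ![α (lineOf (formSign L α w₀) 0), α (lineOf (formSign L α w₀) 2)]).map w₀.1.embedding)) (circleDiagonal_mem_archLocal_diagonal L 2 ![α (lineOf (formSign L α w₀) 0), α (lineOf (formSign L α w₀) 2)] w₀)).range) := ⟨rfl⟩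
  haveI : CompactSpace ↥(Subgroup.map (φ : ↥(unitaryGroupOfForm (starRingEnd ℂ) ((Matrix.diagonal ![α (lineOf (formSign L α w₀) 0), α (lineOf (formSign L α w₀) 2)]).map w₀.1.embedding)) →* ↥(unitaryGroupOfForm (starRingEnd ℂ) J)) ((circleDiagonal 2).codRestrict (unitaryGroupOfForm (starRingEnd ℂ) ((Matrix.diagonal ![α (lineOf (formSign L α w₀) 0), α (lineOf (formSign L α w₀) 2)]).map w₀.1.embedding)) (circleDiagonal_mem_archLocal_diagonal L 2 ![α (lineOf (formSign L α w₀) 0), α (lineOf (formSign L α w₀) 2)] w₀)).range) := isCompact_iff_compactSpace.mp (isCompact_map_circleDiagonal_range L α w₀ φ)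
  have hAcomm : ∀ a b : ↥(Subgroup.map (φ : ↥(unitaryGroupOfForm (starRingEnd ℂ) ((Matrix.diagonal ![α (lineOf (formSign L α w₀) 0), α (lineOf (formSign L α w₀) 2)]).map w₀.1.embedding)) →* ↥(unitaryGroupOfForm (starRingEnd ℂ) J)) ((circleDiagonal 2).codRestrict (unitaryGroupOfForm (starRingEnd ℂ) ((Matrix.diagonal ![α (lineOf (formSign L α w₀) 0), α (lineOf (formSign L α w₀) 2)]).map w₀.1.embedding)) (circleDiagonal_mem_archLocal_diagonal L 2 ![α (lineOf (formSign L α w₀) 0), α (lineOf (formSign L α w₀) 2)] w₀)).range), a * b = b * a := by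
    rintro ⟨_, ⟨x, ⟨u, rfl⟩, rfl⟩⟩ ⟨_, ⟨y, ⟨v, rfl⟩, rfl⟩⟩
    apply Subtype.ext
    show (φ : ↥(unitaryGroupOfForm (starRingEnd ℂ) ((Matrix.diagonal ![α (lineOf (formSign L α w₀) 0), α (lineOf (formSign L α w₀) 2)]).map w₀.1.embedding)) →* ↥(unitaryGroupOfForm (starRingEnd ℂ) J)) _ * (φ : ↥(unitaryGroupOfForm (starRingEnd ℂ) ((Matrix.diagonal ![α (lineOf (formSign L α w₀) 0), α (lineOf (formSign L α w₀) 2)]).map w₀.1.embedding)) →* ↥(unitaryGroupOfForm (starRingEnd ℂ) J)) _ =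
      (φ : ↥(unitaryGroupOfForm (starRingEnd ℂ) ((Matrix.diagonal ![α (lineOf (formSign L α w₀) 0), α (lineOf (formSign L α w₀) 2)]).map w₀.1.embedding)) →* ↥(unitaryGroupOfForm (starRingEnd ℂ) J)) _ * (φ : ↥(unitaryGroupOfForm (starRingEnd ℂ) ((Matrix.diagonal ![α (lineOf (formSign L α w₀) 0), α (lineOf (formSign L α w₀) 2)]).map w₀.1.embedding)) →* ↥(unitaryGroupOfForm (starRingEnd ℂ) J)) _
    rw [← map_mul, ← map_mul, ← map_mul, ← map_mul, mul_comm u v]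
  -- ### a right- and inversion-invariant Haar measure on `Z(γ₀(x₀))` (product decomposition)
  obtain ⟨νM, hνM1, hνM2, hνM3⟩ := (Subgroup.centralizer ({gprimeBlockAt L α w₀ S x₀} : Set ↥(archLocal L 3 (Matrix.diagonal α) w₀))).exists_isHaarMeasure_isMulRightInvariant_isInvInvariant_of_continuousMulEquiv_prod
    hZc K hKc hKcomm e' μ₀
  haveI := hνM1; haveI := hνM2; haveI := hνM3
  -- ### the descent scalar `κ`: `Ψ_*(νM ∕ t₀′) = κ • π_* μ₀` (★ `exists_smul_map_mk_of_block_compact`)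
  haveI : t₀.IsMulRightInvariant := isMulRightInvariant_of_isInvInvariant t₀
  haveI := isHaarMeasure_map_subgroupOfEquivOfLe_symm hT t₀
  haveI := isInvInvariant_map_subgroupOfEquivOfLe_symm hT t₀
  have hTc := isClosed_subgroupOf_of_isClosed _ (Subgroup.centralizer ({gprimeBlockAt L α w₀ S x₀} : Set ↥(archLocal L 3 (Matrix.diagonal α) w₀))) (isClosed_chartTorusGLoc L α w₀ S)
  have hAcpt : IsCompact ((Subgroup.map (φ : ↥(unitaryGroupOfForm (starRingEnd ℂ) ((Matrix.diagonal ![α (lineOf (formSign L α w₀) 0), α (lineOf (formSign L α w₀) 2)]).map w₀.1.embedding)) →* ↥(unitaryGroupOfForm (starRingEnd ℂ) J)) ((circleDiagonal 2).codRestrict (unitaryGroupOfForm (starRingEnd ℂ) ((Matrix.diagonal ![α (lineOf (formSign L α w₀) 0), α (lineOf (formSign L α w₀) 2)]).map w₀.1.embedding)) (circleDiagonal_mem_archLocal_diagonal L 2 ![α (lineOf (formSign L α w₀) 0), α (lineOf (formSign L α w₀) 2)] w₀)).range) :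
      Set ↥(unitaryGroupOfForm (starRingEnd ℂ) J)) := isCompact_iff_compactSpace.mpr inferInstance
  have hA : IsClosed ((Subgroup.map (φ : ↥(unitaryGroupOfForm (starRingEnd ℂ) ((Matrix.diagonal ![α (lineOf (formSign L α w₀) 0), α (lineOf (formSign L α w₀) 2)]).map w₀.1.embedding)) →* ↥(unitaryGroupOfForm (starRingEnd ℂ) J)) ((circleDiagonal 2).codRestrict (unitaryGroupOfForm (starRingEnd ℂ) ((Matrix.diagonal ![α (lineOf (formSign L α w₀) 0), α (lineOf (formSign L α w₀) 2)]).map w₀.1.embedding)) (circleDiagonal_mem_archLocal_diagonal L 2 ![α (lineOf (formSign L α w₀) 0), α (lineOf (formSign L α w₀) 2)] w₀)).range) :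
      Set ↥(unitaryGroupOfForm (starRingEnd ℂ) J)) := hAcpt.isClosed
  letI : CommGroup ↥K := { (inferInstance : Group ↥K) with mul_comm := fun a b => Subtype.ext (hKcomm _ a.2 _ b.2) }
  let νK : Measure ↥K := haarMeasure (Classical.arbitrary (TopologicalSpace.PositiveCompacts ↥K))
  haveI : νK.IsInvInvariant := IsHaarMeasure.isInvInvariant_of_regular νK
  haveI : νK.IsMulRightInvariant := isMulRightInvariant_of_isInvInvariant νK
  letI : CommGroup ↥(Subgroup.map (φ : ↥(unitaryGroupOfForm (starRingEnd ℂ) ((Matrix.diagonal ![α (lineOf (formSign L α w₀) 0), α (lineOf (formSign L α w₀) 2)]).map w₀.1.embedding)) →* ↥(unitaryGroupOfForm (starRingEnd ℂ) J)) ((circleDiagonal 2).codRestrict (unitaryGroupOfForm (starRingEnd ℂ) ((Matrix.diagonal ![α (lineOf (formSign L α w₀) 0), α (lineOf (formSign L α w₀) 2)]).map w₀.1.embedding)) (circleDiagonal_mem_archLocal_diagonal L 2 ![α (lineOf (formSign L α w₀) 0), α (lineOf (formSign L α w₀) 2)] w₀)).range) :=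
    { (inferInstance : Group _) with mul_comm := hAcomm }
  let ρA : Measure ↥(Subgroup.map (φ : ↥(unitaryGroupOfForm (starRingEnd ℂ) ((Matrix.diagonal ![α (lineOf (formSign L α w₀) 0), α (lineOf (formSign L α w₀) 2)]).map w₀.1.embedding)) →* ↥(unitaryGroupOfForm (starRingEnd ℂ) J)) ((circleDiagonal 2).codRestrict (unitaryGroupOfForm (starRingEnd ℂ) ((Matrix.diagonal ![α (lineOf (formSign L α w₀) 0), α (lineOf (formSign L α w₀) 2)]).map w₀.1.embedding)) (circleDiagonal_mem_archLocal_diagonal L 2 ![α (lineOf (formSign L α w₀) 0), α (lineOf (formSign L α w₀) 2)] w₀)).range) :=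
    haarMeasure (Classical.arbitrary (TopologicalSpace.PositiveCompacts _))
  haveI : ρA.IsInvInvariant := IsHaarMeasure.isInvInvariant_of_regular ρA
  obtain ⟨κ, hκ, hmap, -⟩ := exists_smul_map_mk_of_block_compact e' ((chartTorusGLoc L α w₀ S).subgroupOf _) hTc _ hA hmem Ψ hΨ
    (Measure.map (Subgroup.subgroupOfEquivOfLe hT).symm t₀) νM ρA μ₀ νK
  -- ### Harish-Chandra's compactness at `w₀` on a ball around `x₀` (§2) and ONE cut-off `β` (★ p850338)
  obtain ⟨CS, V, hCSc, hVo, hx₀V, hVsimple, hCM⟩ := exists_isCompact_mul_centralizer_ball_gprimeBlockAt L α S w₀ hα hreal₀ hw₀ hx02 hx1 hC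
  obtain ⟨β, hβc, hβs, hβ0, -, hβ1⟩ := exists_continuous_hasCompactSupport_integral_comp_mul_eq_one_pos
    (Subgroup.centralizer ({gprimeBlockAt L α w₀ S x₀} : Set ↥(archLocal L 3 (Matrix.diagonal α) w₀))) hZc νM hCSc
  -- ### the descended FAMILY `(B y)_M^β` (continuous) and its SMOOTH ambient reading `Θ` (§3), the block embedding `Λ`, φ's frame matrix `M₀`
  have haMc : ∀ y, Continuous fun m : ↥(Subgroup.centralizer ({gprimeBlockAt L α w₀ S x₀} : Set ↥(archLocal L 3 (Matrix.diagonal α) w₀))) =>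
      ∫ x, β x • B y (x * (m : ↥(archLocal L 3 (Matrix.diagonal α) w₀)) * x⁻¹) ∂ν₀ := fun y =>
    continuous_integral_conj_subtype ν₀ _ hβc hβs (hBc y)
  obtain ⟨Θ, hΘdef⟩ : ∃ Θ : P × Matrix (Fin 3) (Fin 3) ℂ → ℂ, Θ = fun q =>
      ∫ x, β x • Ξ (q.1, ((x : GL (Fin 3) ℂ) : Matrix (Fin 3) (Fin 3) ℂ) * q.2 * (((x⁻¹ : ↥(archLocal L 3 (Matrix.diagonal α) w₀)) : GL (Fin 3) ℂ) : Matrix (Fin 3) (Fin 3) ℂ)) ∂ν₀ := ⟨_, rfl⟩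
  have hΘ : ContDiff ℝ ∞ Θ := by rw [hΘdef]; exact contDiff_integral_smul_comp_conj_param ν₀ Ξ hΞ β hβc hβs
  have haM : ∀ y (m : ↥(Subgroup.centralizer ({gprimeBlockAt L α w₀ S x₀} : Set ↥(archLocal L 3 (Matrix.diagonal α) w₀)))),
      ∫ x, β x • B y (x * (m : ↥(archLocal L 3 (Matrix.diagonal α) w₀)) * x⁻¹) ∂ν₀ =
        Θ (y, (((m : ↥(archLocal L 3 (Matrix.diagonal α) w₀)) : GL (Fin 3) ℂ) : Matrix (Fin 3) (Fin 3) ℂ)) := fun y m => by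
    rw [hΘdef]
    refine integral_congr_ae (Filter.Eventually.of_forall fun x => ?_)
    simp only [hBΞ, Subgroup.coe_mul, Units.val_mul]
  obtain ⟨Λ, hΛ, hΛb⟩ : ∃ Λ : Matrix (Fin 2) (Fin 2) ℂ → Matrix (Fin 3) (Fin 3) ℂ, ContDiff ℝ ∞ Λ ∧
      ∀ b : ↥(unitaryGroupOfForm (starRingEnd ℂ) ((Matrix.diagonal ![α (lineOf (formSign L α w₀) 0), α (lineOf (formSign L α w₀) 2)]).map w₀.1.embedding)),
        ((((e.symm (b, 1) : ↥(Subgroup.centralizer ({gprimeBlockAt L α w₀ S x₀} : Set ↥(archLocal L 3 (Matrix.diagonal α) w₀)))) :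
            ↥(archLocal L 3 (Matrix.diagonal α) w₀)) : GL (Fin 3) ℂ) : Matrix (Fin 3) (Fin 3) ℂ) = Λ ((b : GL (Fin 2) ℂ) : Matrix (Fin 2) (Fin 2) ℂ) := by
    obtain ⟨Tm, hTm⟩ : ∃ Tm : GL (Fin 3) ℂ, Tm = Matrix.GeneralLinearGroup.mkOfDetNeZero _ (det_monomial_one_ne_zero 3 (lineOf (formSign L α w₀))) := ⟨_, rfl⟩
    refine ⟨fun X => (Tm : Matrix (Fin 3) (Fin 3) ℂ) * (!![X 0 0, 0, X 0 1; 0, 1, 0; X 1 0, 0, X 1 1] : Matrix (Fin 3) (Fin 3) ℂ) * ((Tm⁻¹ : GL (Fin 3) ℂ) : Matrix (Fin 3) (Fin 3) ℂ),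
      (contDiff_const.mul contDiff_blockPattern).mul contDiff_const, fun b => ?_⟩
    have h1 : ((((1 : ↥(unitaryGroupOfForm (starRingEnd ℂ) ((Matrix.diagonal ![(α ∘ (lineOf (formSign L α w₀))) 1]).map w₀.1.embedding))) : GL (Fin 1) ℂ) : Matrix (Fin 1) (Fin 1) ℂ) 0 0) = 1 := by
      rw [OneMemClass.coe_one, Units.val_one, Matrix.one_apply_eq]
    rw [h8 b, ContinuousMulEquiv.coe_restrictSubgroup_apply, GLn.conjEquiv_apply, Units.val_mul, Units.val_mul, coe_endoEmb, coe_endoGL_eq, h1, hTm]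
  obtain ⟨M₀, hM₀⟩ : ∃ M₀ : GL (Fin 2) ℂ, ∀ h : ↥(unitaryGroupOfForm (starRingEnd ℂ) ((Matrix.diagonal ![α (lineOf (formSign L α w₀) 0), α (lineOf (formSign L α w₀) 2)]).map w₀.1.embedding)),
      ((φ h : ↥(unitaryGroupOfForm (starRingEnd ℂ) J)) : GL (Fin 2) ℂ) = M₀ * (h : GL (Fin 2) ℂ) * M₀⁻¹ :=
    ⟨_, fun h => by rw [hval h, _root_.mul_inv_rev]⟩
  have hφsymm : ∀ u : ↥(unitaryGroupOfForm (starRingEnd ℂ) J),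
      (((φ.symm u : ↥(unitaryGroupOfForm (starRingEnd ℂ) ((Matrix.diagonal ![α (lineOf (formSign L α w₀) 0), α (lineOf (formSign L α w₀) 2)]).map w₀.1.embedding))) : GL (Fin 2) ℂ) : Matrix (Fin 2) (Fin 2) ℂ) =
        ((M₀⁻¹ : GL (Fin 2) ℂ) : Matrix (Fin 2) (Fin 2) ℂ) * ((u : GL (Fin 2) ℂ) : Matrix (Fin 2) (Fin 2) ℂ) * ((M₀ : GL (Fin 2) ℂ) : Matrix (Fin 2) (Fin 2) ℂ) := fun u => by
    have h := hM₀ (φ.symm u)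
    rw [ContinuousMulEquiv.apply_symm_apply] at h
    have h' : ((φ.symm u : ↥(unitaryGroupOfForm (starRingEnd ℂ) ((Matrix.diagonal ![α (lineOf (formSign L α w₀) 0), α (lineOf (formSign L α w₀) 2)]).map w₀.1.embedding))) : GL (Fin 2) ℂ) =
        M₀⁻¹ * (u : GL (Fin 2) ℂ) * M₀ := by
      rw [h]; group
    rw [h', Units.val_mul, Units.val_mul]
  -- `e′⁻¹(u, r) = e⁻¹(φ⁻¹ u, 1) · r` for every `r ∈ K₀` (clause [10])
  have hsymm : ∀ (u : ↥(unitaryGroupOfForm (starRingEnd ℂ) J)) (r : ↥K),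
      e'.symm (u, r) = e.symm (φ.symm u, 1) * (r : ↥(Subgroup.centralizer ({gprimeBlockAt L α w₀ S x₀} : Set ↥(archLocal L 3 (Matrix.diagonal α) w₀)))) := fun u r => by
    apply e'.injective
    rw [ContinuousMulEquiv.apply_symm_apply, map_mul, he', he', ContinuousMulEquiv.apply_symm_apply, ContinuousMulEquiv.apply_symm_apply, h10 _ r.2]
    ext <;> simp
  -- ONE compact set `D ⊆ G₀` outside of which every descended family member vanishes, and ONE ambient cut-off `χ ≡ 1` on its block shadow
  have hDc : IsCompact ((fun p : ↥(archLocal L 3 (Matrix.diagonal α) w₀) × ↥(archLocal L 3 (Matrix.diagonal α) w₀) => p.1⁻¹ * p.2 * p.1) '' (tsupport β ×ˢ C)) :=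
    (hβs.isCompact.prod hC).image ((continuous_fst.inv.mul continuous_snd).mul continuous_fst)
  have haM0 : ∀ y ∈ O, ∀ m : ↥(Subgroup.centralizer ({gprimeBlockAt L α w₀ S x₀} : Set ↥(archLocal L 3 (Matrix.diagonal α) w₀))),
      (m : ↥(archLocal L 3 (Matrix.diagonal α) w₀)) ∉ (fun p : ↥(archLocal L 3 (Matrix.diagonal α) w₀) × ↥(archLocal L 3 (Matrix.diagonal α) w₀) => p.1⁻¹ * p.2 * p.1) '' (tsupport β ×ˢ C) →
        ∫ x, β x • B y (x * (m : ↥(archLocal L 3 (Matrix.diagonal α) w₀)) * x⁻¹) ∂ν₀ = 0 := by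
    intro y hy m hm
    refine integral_eq_zero_of_ae (Filter.Eventually.of_forall fun x => ?_)
    by_cases hx : x ∈ tsupport β
    · have hxm : x * (m : ↥(archLocal L 3 (Matrix.diagonal α) w₀)) * x⁻¹ ∉ C := by
        intro hmem'
        exact hm ⟨(x, x * (m : ↥(archLocal L 3 (Matrix.diagonal α) w₀)) * x⁻¹), ⟨hx, hmem'⟩, by dsimp only; group⟩
      show β x • B y (x * (m : ↥(archLocal L 3 (Matrix.diagonal α) w₀)) * x⁻¹) = 0
      rw [hBC y hy _ hxm, smul_zero]
    · show β x • B y (x * (m : ↥(archLocal L 3 (Matrix.diagonal α) w₀)) * x⁻¹) = 0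
      rw [image_eq_zero_of_notMem_tsupport hx, zero_smul]
  have hDM : IsCompact (((↑) : ↥(Subgroup.centralizer ({gprimeBlockAt L α w₀ S x₀} : Set ↥(archLocal L 3 (Matrix.diagonal α) w₀))) → ↥(archLocal L 3 (Matrix.diagonal α) w₀)) ⁻¹'
      ((fun p : ↥(archLocal L 3 (Matrix.diagonal α) w₀) × ↥(archLocal L 3 (Matrix.diagonal α) w₀) => p.1⁻¹ * p.2 * p.1) '' (tsupport β ×ˢ C))) :=
    hZc.isClosedEmbedding_subtypeVal.isCompact_preimage hDc
  have hS₀ : IsCompact ((fun u : ↥(unitaryGroupOfForm (starRingEnd ℂ) J) => ((u : GL (Fin 2) ℂ) : Matrix (Fin 2) (Fin 2) ℂ)) '' (Prod.fst '' (e' ''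
      (((↑) : ↥(Subgroup.centralizer ({gprimeBlockAt L α w₀ S x₀} : Set ↥(archLocal L 3 (Matrix.diagonal α) w₀))) → ↥(archLocal L 3 (Matrix.diagonal α) w₀)) ⁻¹'
        ((fun p : ↥(archLocal L 3 (Matrix.diagonal α) w₀) × ↥(archLocal L 3 (Matrix.diagonal α) w₀) => p.1⁻¹ * p.2 * p.1) '' (tsupport β ×ˢ C)))))) :=
    (((hDM.image e'.continuous).image continuous_fst).image (Units.continuous_val.comp continuous_subtype_val))
  obtain ⟨χ, hχd, hχc, hχ1, -⟩ := Literature.Analysis.Calculus.exists_contDiff_hasCompactSupport_eq_one_of_isCompact hS₀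
  -- the tangential spectator `cw ↦ ↑↑γ₀(0, cw1, 0)` is smooth
  have hupd : ContDiff ℝ ∞ fun cw : Fin 3 → ℝ => (fun _ : {w : InfinitePlace L // IsComplex w} => (![0, cw 1, 0] : Fin 3 → ℝ)) := by
    refine contDiff_pi.2 fun _ => contDiff_pi.2 fun i => ?_
    fin_cases i
    · exact contDiff_const
    · exact contDiff_apply ℝ ℝ 1
    · exact contDiff_const
  have hRρ : ContDiff ℝ ∞ fun cw : Fin 3 → ℝ =>
      (((gprimeBlockAt L α w₀ S ![0, cw 1, 0] : ↥(archLocal L 3 (Matrix.diagonal α) w₀)) : GL (Fin 3) ℂ) : Matrix (Fin 3) (Fin 3) ℂ) :=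
    (contDiff_coe_gprimeBlock L α S w₀).comp hupd
  -- the family `f`
  obtain ⟨f, hf⟩ : ∃ f : (P × (Fin 3 → ℝ)) × Matrix (Fin 2) (Fin 2) ℂ → ℂ, f = fun q =>
      (χ q.2 : ℂ) * Θ (q.1.1, Λ (((M₀⁻¹ : GL (Fin 2) ℂ) : Matrix (Fin 2) (Fin 2) ℂ) * q.2 * ((M₀ : GL (Fin 2) ℂ) : Matrix (Fin 2) (Fin 2) ℂ)) *
        (((gprimeBlockAt L α w₀ S ![0, q.1.2 1, 0] : ↥(archLocal L 3 (Matrix.diagonal α) w₀)) : GL (Fin 3) ℂ) : Matrix (Fin 3) (Fin 3) ℂ)) := ⟨_, rfl⟩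
  have hfs : ContDiff ℝ ∞ f := by
    rw [hf]
    refine ((Complex.ofRealCLM.contDiff.comp ((hχd ⊤).comp contDiff_snd)).mul
      (hΘ.comp ((contDiff_fst.comp contDiff_fst).prodMk
        (((hΛ.comp ((contDiff_const.mul contDiff_snd).mul contDiff_const)).mul (hRρ.comp (contDiff_snd.comp contDiff_fst)))))))
  -- `f ((y, cw), ↑↑u) = (B y)_M^β (e′⁻¹(u, (e γ₀(cw)).2))` for `y ∈ O` and every `cw`, `u`
  have hfB : ∀ y ∈ O, ∀ (cw : Fin 3 → ℝ) (u : ↥(unitaryGroupOfForm (starRingEnd ℂ) J)),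
      (fun m : ↥(Subgroup.centralizer ({gprimeBlockAt L α w₀ S x₀} : Set ↥(archLocal L 3 (Matrix.diagonal α) w₀))) =>
        ∫ x, β x • B y (x * (m : ↥(archLocal L 3 (Matrix.diagonal α) w₀)) * x⁻¹) ∂ν₀)
        (e'.symm (u, (e ⟨gprimeBlockAt L α w₀ S cw, gprimeBlockAt_mem_centralizer L α S w₀ x₀ cw⟩).2)) = f ((y, cw), ((u : GL (Fin 2) ℂ) : Matrix (Fin 2) (Fin 2) ℂ)) := by
    intro y hy cw u
    beta_reduce
    -- the smooth reading of the value
    have hread : Θ (y, ((((e'.symm (u, (e ⟨gprimeBlockAt L α w₀ S cw, gprimeBlockAt_mem_centralizer L α S w₀ x₀ cw⟩).2) :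
        ↥(Subgroup.centralizer ({gprimeBlockAt L α w₀ S x₀} : Set ↥(archLocal L 3 (Matrix.diagonal α) w₀)))) :
          ↥(archLocal L 3 (Matrix.diagonal α) w₀)) : GL (Fin 3) ℂ) : Matrix (Fin 3) (Fin 3) ℂ)) =
        Θ (y, Λ (((M₀⁻¹ : GL (Fin 2) ℂ) : Matrix (Fin 2) (Fin 2) ℂ) * ((u : GL (Fin 2) ℂ) : Matrix (Fin 2) (Fin 2) ℂ) * ((M₀ : GL (Fin 2) ℂ) : Matrix (Fin 2) (Fin 2) ℂ)) *
          (((gprimeBlockAt L α w₀ S ![0, cw 1, 0] : ↥(archLocal L 3 (Matrix.diagonal α) w₀)) : GL (Fin 3) ℂ) : Matrix (Fin 3) (Fin 3) ℂ)) := by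
      rw [hsymm, Subgroup.coe_mul, Subgroup.coe_mul, Units.val_mul, hΛb (φ.symm u), hφsymm u, h6 cw]
    by_cases hu : (e'.symm (u, (e ⟨gprimeBlockAt L α w₀ S cw, gprimeBlockAt_mem_centralizer L α S w₀ x₀ cw⟩).2)) ∈
        (((↑) : ↥(Subgroup.centralizer ({gprimeBlockAt L α w₀ S x₀} : Set ↥(archLocal L 3 (Matrix.diagonal α) w₀))) → ↥(archLocal L 3 (Matrix.diagonal α) w₀)) ⁻¹'
          ((fun p : ↥(archLocal L 3 (Matrix.diagonal α) w₀) × ↥(archLocal L 3 (Matrix.diagonal α) w₀) => p.1⁻¹ * p.2 * p.1) '' (tsupport β ×ˢ C)))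
    · have hχu : χ ((u : GL (Fin 2) ℂ) : Matrix (Fin 2) (Fin 2) ℂ) = 1 :=
        hχ1 _ ⟨u, ⟨(u, (e ⟨gprimeBlockAt L α w₀ S cw, gprimeBlockAt_mem_centralizer L α S w₀ x₀ cw⟩).2), ⟨_, hu, e'.apply_symm_apply _⟩, rfl⟩, rfl⟩
      rw [hf]
      beta_reduce
      rw [hχu, Complex.ofReal_one, one_mul, haM, hread]
    · have h0 := haM0 y hy _ hu
      beta_reduce at h0
      have h0' := h0
      rw [haM, hread] at h0'
      rw [h0, hf]
      beta_reduce
      rw [h0', mul_zero]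
  -- ### the descent constant `K = κ ≠ 0`
  have hK0 : (((κ : ℝ) : ℂ)) ≠ 0 := Complex.ofReal_ne_zero.2 (NNReal.coe_ne_zero.2 hκ)
  -- ### the quotient measure on `G₀ ⧸ T₀` is finite on compacts
  haveI : IsFiniteMeasureOnCompacts (quotientMeasure (chartTorusGLoc L α w₀ S) t₀ (isClosed_chartTorusGLoc L α w₀ S) ν₀) := inferInstance
  -- ### the block reading of `γ₀(cw)` through `e′` ([5] + (B-STD) (i))
  have hγ : ∀ cw : Fin 3 → ℝ,
      e' ⟨gprimeBlockAt L α w₀ S cw, hT (gprimeBlockAt_mem_chartTorusGLoc L α w₀ S cw)⟩ =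
        ((⟨Matrix.GeneralLinearGroup.mkOfDetNeZero !![(1 : ℂ), 1; 1, -1] det_cayleyTwo_ne_zero *
            circleDiagonal 2 ![Circle.exp (cw 0), Circle.exp (cw 2)] *
            (Matrix.GeneralLinearGroup.mkOfDetNeZero !![(1 : ℂ), 1; 1, -1] det_cayleyTwo_ne_zero)⁻¹, cayley_conj_circleDiagonal_mem_of_eq_over hJ _⟩ : ↥(unitaryGroupOfForm (starRingEnd ℂ) J)),
          (e ⟨gprimeBlockAt L α w₀ S cw, gprimeBlockAt_mem_centralizer L α S w₀ x₀ cw⟩).2) := by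
    intro cw
    have h1 : (e ⟨gprimeBlockAt L α w₀ S cw, gprimeBlockAt_mem_centralizer L α S w₀ x₀ cw⟩).1 =
        ⟨circleDiagonal 2 ![Circle.exp (cw 0), Circle.exp (cw 2)],
          circleDiagonal_mem_unitaryGroupOfForm_diagonal_map_weights w₀.1.embedding ![α (lineOf (formSign L α w₀) 0), α (lineOf (formSign L α w₀) 2)] _⟩ :=
      Subtype.ext (h5 cw)
    rw [he', h1, hφ]
  -- ### assembling
  refine ⟨((κ : ℝ) : ℂ), V, f, hK0, hVo, hx₀V, hfs, ⟨tsupport χ, hχc, fun y cw X hX => ?_⟩, fun y cw X => ?_, ?_⟩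
  · rw [hf]; dsimp only; rw [image_eq_zero_of_notMem_tsupport hX, Complex.ofReal_zero, zero_mul]
  · rw [hf]; dsimp only
    simp
  intro y hy cw hcw hreg
  -- regularity of `cw` and integrability of the orbital integrand on `G₀ ⧸ T₀` (`T₀` is compact at a compact-chart place)
  have hinj : Function.Injective fun i : Fin 3 => Circle.exp (cw i) :=
    injective_fin_three_of_ne (f := fun i : Fin 3 => Circle.exp (cw i)) (hVsimple cw hcw).1.symm hreg (hVsimple cw hcw).2
  have hw : ¬ (w₀ ∈ S ∧ w₀ ∈ splitChartPlaces L α) := fun h => hw₀ h.1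
  obtain ⟨𝒦, h𝒦, hmem𝒦⟩ := uniformlyProper_gprimeBlock_cpt_of_injective L α S hα hw (chartTorusGLoc L α w₀ S) {cw}
    (Set.singleton_subset_iff.2 hinj) isCompact_singleton C hC
  have hint : Integrable (descConj (gprimeBlockAt L α w₀ S cw) (chartTorusGLoc L α w₀ S) (forall_mem_chartTorusGLoc_comm L α w₀ S cw) (B y))
      (quotientMeasure (chartTorusGLoc L α w₀ S) t₀ (isClosed_chartTorusGLoc L α w₀ S) ν₀) :=
    integrable_descConj_of_exists_isCompact (chartTorusGLoc L α w₀ S) (isClosed_chartTorusGLoc L α w₀ S) _ (forall_mem_chartTorusGLoc_comm L α w₀ S cw) (hBc y)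
      h𝒦 (fun q hq => hmem𝒦 cw (Set.mem_singleton cw) q (hBts y hy hq)) _
  -- ★ D3: descent to `Z(γ₀(x₀))` with the cut-off `β`
  have key := integral_descConj_eq_integral_descConj_descended ν₀ (Subgroup.centralizer ({gprimeBlockAt L α w₀ S x₀} : Set ↥(archLocal L 3 (Matrix.diagonal α) w₀))) hZc νM
    ⟨gprimeBlockAt L α w₀ S cw, hT (gprimeBlockAt_mem_chartTorusGLoc L α w₀ S cw)⟩
    (chartTorusGLoc L α w₀ S) (isClosed_chartTorusGLoc L α w₀ S) (forall_mem_chartTorusGLoc_comm L α w₀ S cw)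
    ((chartTorusGLoc L α w₀ S).subgroupOf (Subgroup.centralizer ({gprimeBlockAt L α w₀ S x₀} : Set ↥(archLocal L 3 (Matrix.diagonal α) w₀)))) hTc
    (fun t ht => Subtype.ext (forall_mem_chartTorusGLoc_comm L α w₀ S cw (t : ↥(archLocal L 3 (Matrix.diagonal α) w₀)) (Subgroup.mem_subgroupOf.1 ht)))
    (fun t ht => Subgroup.mem_subgroupOf.1 ht)
    t₀ (Measure.map (Subgroup.subgroupOfEquivOfLe hT).symm t₀)
    (eq_map_incl_map_subgroupOfEquivOfLe_symm hT t₀)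
    hβc hβs hβ0 hβ1 (hBc y) hint (fun q hq => hCM cw hcw q (hBts y hy hq))
  refine key.trans ?_
  rw [integral_descConj_eq_smul_integral_of_block _ _ e' Ψ hΨ _ μ₀ hmap _ _ _ (hγ cw) _ (haMc y), NNReal.smul_def, Complex.real_smul]
  congr 1
  refine integral_congr_ae (Filter.Eventually.of_forall fun b => ?_)
  exact hfB y hy cw _

end Local

end Literature.NumberTheory.Rogawski1990

end
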